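import Literature.NumberTheory.LFunctions.ZetaSqReflectionPrinciple
import Literature.Analysis.SpecialFunctions.GammaProductBounds
import HarnessLib

/-!
# Double zeta sums, II: the reflection principle for smoothed critical-line zeta sums (Ivić (4.67))

Topic `NumberTheory/LFunctions`, family RH. Second file toward Heath-Brown's estimate for double
zeta sums (Ivić, *The Riemann Zeta-Function* (1985), Lemma 11.5 = Heath-Brown, J. London Math.
Soc. (2) 20 (1979), Theorem 1 = Guth–Maynard, Ann. of Math. 203 (2026), Theorem 1.6); see
`DoubleZetaSums.lean` for the elementary half. This file PROVES the analytic input of Ivić's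
Lemma 11.4, the reflection principle (4.67) for the smoothed zeta sum
`∑_n (e^{-(n/2Y)^h} − e^{-(n/Y)^h}) n^{-s}` on the critical line, in the following variant (the
tail of the reflected Dirichlet series is estimated on a FIXED line `re = 3/2 + k` instead of
Ivić's receding line `re(s+w) = −h/2`, at the price of a reflected sum of length `T^{1+O(1/k)}/Y`
in place of `3T/Y`; this avoids Stirling's formula for `Γ` uniformly in the real part).

No named fact is introduced; everything in this file is proved. The variable is `z = w/h`
(`w` Ivić's), so that the kernel `Γ(1+w/h)w^{-1}Y^w dw` becomes `Γ(z)Y^{hz} dz`, the Cahen–Mellin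
integral of the tree applies (`MellinBarnes.integral_cpow_neg_mul_Gamma`), and the bounds for `Γ`
on vertical lines of the tree (`HuxleyZeroDetection.norm_Gamma_vertical_le`, `…_neg_line_le_exp`,
`Literature.Analysis.SpecialFunctions.norm_Gamma_add_nat_le`, `…norm_Gamma_le_exp`) are used at
fixed real parts only.

## The argument

For `re s = 1/2`, `h ≥ 2(k+1)`, `Y ≥ 1` put `D_Y(z) = Γ(z) Y^{hz} ζ(s+hz)` (`DZSReflection.mel`).
* §2: `W(Y) := ∑_{m≥1} e^{-(m/Y)^h} m^{-s} = (2π)^{-1}∫ D_Y(2+iy) dy` (`tsum_weight_eq_integral`).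
* §3: `D_Y` is `O((1+|y|)^{k+6}e^{-π|y|/2})` on `−(k+1)/h ≤ re z ≤ 2` (`norm_mel_le`, from
  `norm_zeta_le_pow_left`: `ζ` of polynomial growth for `re ≥ −1/2−k` via the functional equation);
  shift `re z = 2 → 1/(4h)` across `z₀ = (1−s)/h` (`shift_two_quarter`, residue
  `Γ(z₀)Y^{hz₀}ζ₁(1)/h`) and `1/(4h) → −(k+1)/h` across `0` (`shift_quarter_left`, residue `ζ(s)`,
  the same for `Y` and `2Y`).
* §4: on `re z = −(k+1)/h`, `ζ(s+hz) = F(1−s−hz)(A_M + R_M)(1−s−hz)` (`mel_eq_finE_add_tailT`,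
  `A_M(v) = ∑_{n≤M} n^{-v}`, `re(1−s−hz) = 3/2+k`); the tail part has
  `∫‖T_Y‖ ≤ tailB ≍_k h(3+k+|t|+h)^{k+3}Y^{-(k+1)}(M+1)^{-(k+1/4)}` (`integral_norm_tailT_le`).
* §5: the finite part `E_Y` is holomorphic on `−(k+1)/h ≤ re z ≤ −δ/h` and is moved to
  `re z = −δ/h` (`shift_finE`), where
  `‖∫(E_{2Y} − E_Y)‖ ≤ (192π²h²/δ)(1+|t|)^δ ∫(1+|y|)³e^{-π|y|/2}‖A_M(1/2+δ−i(t+hy))‖ dy`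
  (`norm_integral_finE_sub_le`).
* §6: the residue at `z₀` is `≤ resB = 16π²(1+|t|/h)^{1/2}e^{-π|t|/(2h)}Y^{1/2}/h` (`norm_numA_le`),
  the identity `wsum_sub_wsum_eq` and the bound `norm_wsum_sub_wsum_le`.

## Main statements (all proved)

* `DZSReflection.tsum_weight_eq_integral` — Ivić (4.60) (`k = 1`) on `re z = 2`.
* `DZSReflection.shift_two_quarter`, `DZSReflection.shift_quarter_left`, `DZSReflection.shift_finE`
  — the three contour shifts.
* `DZSReflection.norm_wsum_sub_wsum_le` — **the reflection principle (Ivić (4.67), variant)**: for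
  `re s = 1/2`, `2(k+1) ≤ h ≤ |im s|`, `Y ≥ 1`, `M ∈ ℕ`, `0 < δ ≤ 1/2`,
  `‖W(2Y) − W(Y)‖ ≤ resB(2Y) + resB(Y) + (2π)^{-1}(tailB(2Y) + tailB(Y))
    + (2π)^{-1}(192π²h²/δ)(1+|im s|)^δ · mainI`,
  `mainI = ∫(1+|y|)³e^{-π|y|/2}‖A_M(1 − s − h(−δ/h+iy))‖ dy`; with `h = log²T`, `|im s| ≥ log⁴T`,
  `Y ≤ T²`, `δ = 1/log T`, `M + 1 ≥ T^{(k+4)/(k+1/4)}/Y` the first four terms are `≤ 1` for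
  `T ≥ T₀(k)` (done in the sequel, with Ivić's Lemma 11.4).
* `DZSReflection.dirA_eq_sum_Icc` — `A_M(v) = ∑_{m∈[1,M]} m^{-v}`, the form consumed by the double
  zeta sums of `DoubleZetaSums.lean`.

## References

* A. Ivić, *The Riemann Zeta-Function*, Wiley 1985 (Dover 2003), §4.4 (4.59)–(4.67), §11.6
  Lemma 11.4. [key `Ivic1985`]
* D. R. Heath-Brown, *A large values estimate for Dirichlet polynomials*, J. London Math. Soc. (2)
  20 (1979), 8–18, Lemma 3.
-/

noncomputable section

open Real Complex MeasureTheory Set Filter Topology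
open scoped ComplexConjugate

namespace Literature.NumberTheory.LFunctions

namespace DZSReflection

open HuxleyZeroDetection ZetaM4 MellinBarnes
open Literature.Analysis.SpecialFunctions Literature.Analysis.SpecialFunctions.GammaVert

/-! ## §1. Tools: integrability from decay, powers, the factor `F` and `ζ` to the left -/

/-- A continuous function on `ℝ` which is dominated by an integrable function outside a compact
interval is integrable. [folklore] -/
theorem integrable_of_continuous_of_le {f : ℝ → ℂ} (hf : Continuous f) {g : ℝ → ℝ}
    (hg : Integrable g) {R : ℝ} (hfg : ∀ y, R ≤ |y| → ‖f y‖ ≤ g y) : Integrable f := by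
  obtain ⟨C, hC⟩ := (isCompact_Icc : IsCompact (Icc (-|R|) |R|)).exists_bound_of_continuousOn
    hf.continuousOn
  set G : ℝ → ℝ := fun y ↦ |g y| + (Icc (-|R|) |R|).indicator (fun _ ↦ C) y with hG
  have hGi : Integrable G := by
    refine hg.abs.add ?_
    exact (continuous_const.integrableOn_Icc (a := -|R|) (b := |R|)).integrable_indicator
      measurableSet_Icc
  refine hGi.mono' hf.aestronglyMeasurable (Eventually.of_forall fun y ↦ ?_)
  by_cases hy : y ∈ Icc (-|R|) |R|
  · rw [hG]; dsimp only
    rw [indicator_of_mem hy]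
    exact (hC y hy).trans (le_add_of_nonneg_left (abs_nonneg _))
  · rw [hG]; dsimp only
    rw [indicator_of_notMem hy, add_zero]
    have hRy : R ≤ |y| := by
      simp only [mem_Icc, not_and_or, not_le] at hy
      have hR := le_abs_self R
      rcases hy with h | h
      · have hy0 : y < 0 := by linarith [abs_nonneg R]
        rw [abs_of_neg hy0]; linarith
      · linarith [le_abs_self y]
    exact (hfg y hRy).trans (le_abs_self _)

/-- `((x^a)^w = x^{aw}` for real `x > 0`, real `a`, complex `w`. [folklore] -/
theorem ofReal_rpow_cpow {x : ℝ} (hx : 0 < x) (a : ℝ) (w : ℂ) :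
    (((x ^ a : ℝ)) : ℂ) ^ w = (x : ℂ) ^ ((a : ℂ) * w) := by
  have hxa : 0 < x ^ a := Real.rpow_pos_of_pos hx a
  rw [Complex.cpow_def_of_ne_zero (ofReal_ne_zero.2 hxa.ne'),
    Complex.cpow_def_of_ne_zero (ofReal_ne_zero.2 hx.ne'), ← Complex.ofReal_log hxa.le,
    Real.log_rpow hx, ← Complex.ofReal_log hx.le]
  push_cast
  ring_nf

/-- `‖Y^{a z}‖ = Y^{a re z}` for `Y > 0`, `a` real. [folklore] -/
theorem norm_cpow_ofReal_mul {Y : ℝ} (hY : 0 < Y) (a : ℝ) (z : ℂ) :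
    ‖(Y : ℂ) ^ ((a : ℂ) * z)‖ = Y ^ (a * z.re) := by
  rw [norm_ofReal_cpow hY]
  congr 1
  simp

/-- **The factor of the functional equation has polynomial growth**: for `1/2 ≤ x ≤ k + 2` and all
real `y`, `‖F(x+iy)‖ ≤ 32π² (3 + k + |y|)^{k+3}` (`F(s) = 2(2π)^{-s}Γ(s)cos(πs/2)`; from the
tree's bounds `‖F‖ ≤ 8π²(1+|y|)^{x−1/2}` on `1/2 ≤ x ≤ 1` and
`‖Γ(x₀+n+iy)‖ ≤ 16π²(1+|y|)^{3/2}e^{-π|y|/2}∏_{j<n}(x₀+j+|y|)`). [folklore] -/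
theorem norm_feFactor_le_pow (k : ℕ) {x : ℝ} (hx1 : 1 / 2 ≤ x) (hx2 : x ≤ k + 2) (y : ℝ) :
    ‖feFactor (x + y * I)‖ ≤ 32 * π ^ 2 * (3 + k + |y|) ^ (k + 3) := by
  have hπ := Real.pi_gt_three
  have hy0 := abs_nonneg y
  have hk0 : (0 : ℝ) ≤ k := k.cast_nonneg
  have hB : 1 ≤ 3 + (k : ℝ) + |y| := by linarith
  have hB' : 1 + |y| ≤ 3 + (k : ℝ) + |y| := by linarith
  rcases le_or_gt x 1 with h1 | h1
  · have h := GammaVert.norm_fe_factor_le (s := x + y * I) (by simpa using hx1) (by simpa using h1)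
    have hre : ((x : ℂ) + y * I).re = x := by simp
    have him : ((x : ℂ) + y * I).im = y := by simp
    rw [hre, him] at h
    have hF : ‖feFactor (x + y * I)‖ ≤ 8 * π ^ 2 * (1 + |y|) ^ (x - 1 / 2) := h
    calc ‖feFactor (x + y * I)‖ ≤ 8 * π ^ 2 * (1 + |y|) ^ (x - 1 / 2) := hF
      _ ≤ 8 * π ^ 2 * (1 + |y|) ^ (1 : ℝ) := by
          gcongr
          · linarith
          · linarith
      _ ≤ 32 * π ^ 2 * (3 + k + |y|) ^ (k + 3) := by
          rw [Real.rpow_one]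
          have h2 : (1 + |y|) ≤ (3 + k + |y|) ^ (k + 3) := by
            calc (1 + |y|) ≤ (3 + k + |y|) ^ 1 := by rw [pow_one]; linarith
              _ ≤ (3 + k + |y|) ^ (k + 3) := pow_le_pow_right₀ hB (by omega)
          nlinarith [Real.pi_pos]
  · -- `x = x₀ + n`, `x₀ ∈ [1, 2)`, `n ≤ k + 1`
    have hfl : (⌊x⌋₊ : ℝ) ≤ x := Nat.floor_le (by linarith)
    have hfl' : x < ⌊x⌋₊ + 1 := Nat.lt_floor_add_one x
    have h1fl : 1 ≤ ⌊x⌋₊ := (Nat.one_le_floor_iff x).2 h1.le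
    have hflk : ⌊x⌋₊ ≤ k + 2 := Nat.floor_le_of_le (by push_cast; linarith)
    set n : ℕ := ⌊x⌋₊ - 1 with hn
    have hn' : (n : ℝ) = ⌊x⌋₊ - 1 := by
      rw [hn, Nat.cast_sub h1fl]; simp
    set x₀ : ℝ := x - n with hx₀
    have hx₀1 : 1 ≤ x₀ := by rw [hx₀, hn']; linarith
    have hx₀2 : x₀ ≤ 2 := by rw [hx₀, hn']; linarith
    have hnk : n ≤ k + 1 := by omega
    have hΓ := norm_Gamma_add_nat_le hx₀1 hx₀2 n y
    have e : ((x₀ + n : ℝ) : ℂ) + y * I = (x : ℂ) + y * I := by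
      rw [hx₀]; push_cast; ring
    rw [e] at hΓ
    have hprod : ∏ j ∈ Finset.range n, (x₀ + j + |y|) ≤ (3 + k + |y|) ^ n := by
      calc ∏ j ∈ Finset.range n, (x₀ + j + |y|) ≤ ∏ _j ∈ Finset.range n, (3 + k + |y|) := by
            refine Finset.prod_le_prod (fun j _ ↦ by positivity) fun j hj ↦ ?_
            have hj' : (j : ℝ) ≤ n := by exact_mod_cast (Finset.mem_range.1 hj).le
            have hnk' : (n : ℝ) ≤ k + 1 := by exact_mod_cast hnk
            linarith
        _ = (3 + k + |y|) ^ n := by rw [Finset.prod_const, Finset.card_range]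
    have h32 : (1 + |y|) ^ (3 / 2 : ℝ) ≤ (3 + k + |y|) ^ 2 := by
      calc (1 + |y|) ^ (3 / 2 : ℝ) ≤ (1 + |y|) ^ (2 : ℝ) :=
            Real.rpow_le_rpow_of_exponent_le (by linarith) (by norm_num)
        _ = (1 + |y|) ^ 2 := by norm_cast
        _ ≤ (3 + k + |y|) ^ 2 := pow_le_pow_left₀ (by linarith) hB' 2
    have hΓ' : ‖Complex.Gamma (x + y * I)‖ ≤
        16 * π ^ 2 * (3 + k + |y|) ^ (k + 3) * Real.exp (-(π * |y|) / 2) := by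
      refine hΓ.trans ?_
      have hE := Real.exp_pos (-(π * |y|) / 2)
      calc 16 * π ^ 2 * (1 + |y|) ^ (3 / 2 : ℝ) * Real.exp (-(π * |y|) / 2) *
            ∏ j ∈ Finset.range n, (x₀ + j + |y|)
          ≤ 16 * π ^ 2 * (3 + k + |y|) ^ 2 * Real.exp (-(π * |y|) / 2) * (3 + k + |y|) ^ n := by
            gcongr
        _ = 16 * π ^ 2 * (3 + k + |y|) ^ (n + 2) * Real.exp (-(π * |y|) / 2) := by ring
        _ ≤ 16 * π ^ 2 * (3 + k + |y|) ^ (k + 3) * Real.exp (-(π * |y|) / 2) := by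
            gcongr 16 * π ^ 2 * ?_ * _
            exact pow_le_pow_right₀ hB (by omega)
    have hF := norm_feFactor_le x y
    have h2pi : (2 * π) ^ (-x) ≤ 1 :=
      Real.rpow_le_one_of_one_le_of_nonpos (by linarith) (by linarith)
    have hee : Real.exp (-(π * |y|) / 2) * Real.exp (π * |y| / 2) = 1 := by
      rw [← Real.exp_add]; convert Real.exp_zero using 2; ring
    calc ‖feFactor (x + y * I)‖
        ≤ 2 * (2 * π) ^ (-x) * ‖Complex.Gamma (x + y * I)‖ * Real.exp (π * |y| / 2) := hF
      _ ≤ 2 * 1 * (16 * π ^ 2 * (3 + k + |y|) ^ (k + 3) * Real.exp (-(π * |y|) / 2)) *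
          Real.exp (π * |y| / 2) := by gcongr
      _ = 32 * π ^ 2 * (3 + k + |y|) ^ (k + 3) * (Real.exp (-(π * |y|) / 2) * Real.exp (π * |y| / 2)) := by
          ring
      _ = 32 * π ^ 2 * (3 + k + |y|) ^ (k + 3) := by rw [hee, mul_one]

/-- **Polynomial growth of `ζ` to the left**: for `re u ≥ −1/2 − k` and `|im u| ≥ 1`,
`‖ζ(u)‖ ≤ 1000 (3 + k + |im u|)^{k+4}` (for `re u ≥ −1` the tree's Euler–Maclaurin bound
`192(1+|im u|)³`, resp. `2` for `re u ≥ 2`; further left the functional equation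
`ζ(u) = F(1−u)ζ(1−u)` and the bound for `F`). [folklore] -/
theorem norm_zeta_le_pow_left (k : ℕ) {u : ℂ} (hu : -(1 / 2 : ℝ) - k ≤ u.re) (hy : 1 ≤ |u.im|) :
    ‖riemannZeta u‖ ≤ 1000 * (3 + k + |u.im|) ^ (k + 4) := by
  have hπ := Real.pi_gt_three
  have hπ4 := Real.pi_lt_four
  have hy0 := abs_nonneg u.im
  have hk0 : (0 : ℝ) ≤ k := k.cast_nonneg
  have hB : 1 ≤ 3 + (k : ℝ) + |u.im| := by linarith
  have hBpow : ∀ m : ℕ, (1 : ℝ) ≤ (3 + k + |u.im|) ^ m := fun m ↦ one_le_pow₀ hB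
  have hsub1 : 1 / 2 ≤ ‖u - 1‖ := half_le_norm_sub_one_of_im hy
  rcases le_or_gt 2 u.re with h2 | h2
  · calc ‖riemannZeta u‖ ≤ 2 := norm_zeta_le_two h2
      _ ≤ 1000 * (3 + k + |u.im|) ^ (k + 4) := by nlinarith [hBpow (k + 4)]
  rcases le_or_gt (-1) u.re with h1 | h1
  · calc ‖riemannZeta u‖ ≤ 192 * (1 + |u.im|) ^ 3 := norm_zeta_le_poly h1 (by linarith) hsub1
      _ ≤ 192 * (3 + k + |u.im|) ^ (k + 4) := by
          gcongr 192 * ?_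
          calc (1 + |u.im|) ^ 3 ≤ (3 + k + |u.im|) ^ 3 := pow_le_pow_left₀ (by linarith) (by linarith) 3
            _ ≤ (3 + k + |u.im|) ^ (k + 4) := pow_le_pow_right₀ hB (by omega)
      _ ≤ 1000 * (3 + k + |u.im|) ^ (k + 4) := by nlinarith [hBpow (k + 4)]
  · -- functional equation
    have hu0 : u ≠ 0 := fun h ↦ by rw [h] at hy; simp at hy; linarith
    have hun : ∀ n : ℕ, u ≠ 1 + n := fun n h ↦ by
      have := congrArg Complex.im h; simp at this; rw [this] at hy; simp at hy; linarith
    rw [riemannZeta_eq_feFactor_mul hun hu0, norm_mul]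
    have hre : (1 - u).re = 1 - u.re := by simp
    have him : (1 - u).im = -u.im := by simp
    have e1 : (1 - u) = ((1 - u.re : ℝ) : ℂ) + ((-u.im : ℝ) : ℂ) * I := by
      apply Complex.ext <;> simp
    have hF : ‖feFactor (1 - u)‖ ≤ 32 * π ^ 2 * (3 + k + |u.im|) ^ (k + 3) := by
      rw [e1]
      have := norm_feFactor_le_pow k (x := 1 - u.re) (by linarith) (by linarith) (-u.im)
      rwa [abs_neg] at this
    have hζ : ‖riemannZeta (1 - u)‖ ≤ 2 := norm_zeta_le_two (by rw [hre]; linarith)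
    calc ‖feFactor (1 - u)‖ * ‖riemannZeta (1 - u)‖
        ≤ 32 * π ^ 2 * (3 + k + |u.im|) ^ (k + 3) * 2 := by gcongr
      _ ≤ 1000 * (3 + k + |u.im|) ^ (k + 3) * 1 := by
          have hπ2 : π ^ 2 < 10 := by nlinarith [Real.pi_lt_d2, Real.pi_pos]
          nlinarith [hBpow (k + 3)]
      _ ≤ 1000 * (3 + k + |u.im|) ^ (k + 3) * (3 + k + |u.im|) := by gcongr
      _ = 1000 * (3 + k + |u.im|) ^ (k + 4) := by ring

/-! ## §2. The Mellin integral for the weights `e^{-(n/Y)^h}` (Ivić (4.59)–(4.60))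

We work in the variable `z = w/h` of Ivić's `w`: the kernel `Γ(1 + w/h) w^{-1} Y^w` becomes
`Γ(z) Y^{hz}` (up to the substitution), and the Cahen–Mellin integral of the tree
(`MellinBarnes.integral_cpow_neg_mul_Gamma`, `∫ x^{-(2+iy)} Γ(2+iy) dy = 2π e^{-x}`) applies with
`x = (n/Y)^h`. -/

/-- **The Mellin–Barnes integrand** `D_Y(z) = Γ(z) Y^{hz} ζ(s + hz)` (Ivić's
`ζ(s+w) Y^w Γ(1+w/h) w^{-1}` in the variable `z = w/h`, up to the factor `dw/dz = h` absorbed by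
`Γ(1+z) = zΓ(z)`). [cite: Ivic1985, Section 4.4 (4.60)] -/
def mel (s : ℂ) (h Y : ℝ) (z : ℂ) : ℂ :=
  Complex.Gamma z * (Y : ℂ) ^ ((h : ℂ) * z) * riemannZeta (s + h * z)

/-- The terms on the line `re z = 2`: `Γ(2+iy) Y^{h(2+iy)} (m+1)^{-(s+h(2+iy))}
= (m+1)^{-s} · x_m^{-(2+iy)} Γ(2+iy)` with `x_m = ((m+1)/Y)^h`. [folklore] -/
theorem term_eq {Y : ℝ} (hY : 0 < Y) (h : ℝ) (s : ℂ) (m : ℕ) (y : ℝ) :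
    Complex.Gamma (2 + y * I) * (Y : ℂ) ^ ((h : ℂ) * (2 + y * I)) *
        (1 / ((m : ℂ) + 1) ^ (s + h * (2 + y * I))) =
      ((m : ℂ) + 1) ^ (-s) *
        (((((m + 1 : ℝ) / Y) ^ h : ℝ) : ℂ) ^ (-(2 + y * I)) * Complex.Gamma (2 + y * I)) := by
  have hm : (0 : ℝ) < m + 1 := by positivity
  have hm0 : ((m : ℂ) + 1) ≠ 0 := by
    have : ((m + 1 : ℝ) : ℂ) ≠ 0 := ofReal_ne_zero.2 hm.ne'
    push_cast at this; exact this
  rw [ofReal_rpow_cpow (div_pos hm hY), show ((h : ℂ) * -(2 + y * I)) = -((h : ℂ) * (2 + y * I)) by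
    ring, div_ofReal_cpow_neg hm.le hY, one_div, ← Complex.cpow_neg, neg_add,
    Complex.cpow_add _ _ hm0]
  push_cast
  ring

/-- The integral of one term: `∫ Γ(2+iy) Y^{h(2+iy)} (m+1)^{-(s+h(2+iy))} dy
= 2π e^{-((m+1)/Y)^h} (m+1)^{-s}`. [cite: Ivic1985, Section 4.4 (4.59)] -/
theorem integral_term {Y : ℝ} (hY : 0 < Y) (h : ℝ) (s : ℂ) (m : ℕ) :
    ∫ y : ℝ, Complex.Gamma (2 + y * I) * (Y : ℂ) ^ ((h : ℂ) * (2 + y * I)) *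
        (1 / ((m : ℂ) + 1) ^ (s + h * (2 + y * I))) =
      2 * π * ((Real.exp (-(((m + 1 : ℝ) / Y) ^ h)) : ℂ) * ((m : ℂ) + 1) ^ (-s)) := by
  simp_rw [term_eq hY h s m]
  rw [integral_const_mul, integral_cpow_neg_mul_Gamma
    (Real.rpow_pos_of_pos (div_pos (by positivity) hY) h)]
  ring

/-- The norm of one term: `Y^{2h} (m+1)^{-(re s + 2h)} ‖Γ(2+iy)‖`. [folklore] -/
theorem norm_term_eq {Y : ℝ} (hY : 0 < Y) (h : ℝ) (s : ℂ) (m : ℕ) (y : ℝ) :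
    ‖Complex.Gamma (2 + y * I) * (Y : ℂ) ^ ((h : ℂ) * (2 + y * I)) *
        (1 / ((m : ℂ) + 1) ^ (s + h * (2 + y * I)))‖ =
      Y ^ (2 * h) * ((m + 1 : ℝ) ^ (-(s.re + 2 * h))) * ‖Complex.Gamma (2 + y * I)‖ := by
  have hm : (0 : ℝ) < m + 1 := by positivity
  rw [norm_mul, norm_mul, norm_cpow_ofReal_mul hY, norm_div, norm_one,
    show ((m : ℂ) + 1) = ((m + 1 : ℝ) : ℂ) by push_cast; ring,
    Complex.norm_cpow_eq_rpow_re_of_pos hm]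
  have hre : (s + (h : ℂ) * (2 + (y : ℂ) * I)).re = s.re + 2 * h := by
    simp; ring
  have hre2 : (2 + (y : ℂ) * I).re = 2 := by simp
  rw [hre, hre2, Real.rpow_neg hm.le, show h * 2 = 2 * h by ring]
  ring

/-- Summability of `∑ (m+1)^{-p}` for `p > 1`, in the form used here. [folklore] -/
theorem summable_nat_add_one_rpow_neg {p : ℝ} (hp : 1 < p) :
    Summable fun m : ℕ ↦ (m + 1 : ℝ) ^ (-p) := by
  have h := (summable_nat_add_iff 1).2 (Real.summable_nat_rpow_inv.2 hp)
  refine h.congr fun m ↦ ?_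
  push_cast
  rw [Real.rpow_neg (by positivity)]

/-- **Ivić's (4.60) for `k = 1`, on the line `re z = 2`**: for `Y > 0` and `re s + 2h > 1`,
`∑_{m≥1} e^{-(m/Y)^h} m^{-s} = (2π)^{-1} ∫ Γ(2+iy) Y^{h(2+iy)} ζ(s + h(2+iy)) dy` (absolute
convergence and termwise integration). [cite: Ivic1985, Section 4.4 (4.60)] -/
theorem tsum_weight_eq_integral {Y h : ℝ} (hY : 0 < Y) {s : ℂ} (hs : 1 < s.re + 2 * h) :
    ∑' m : ℕ, (Real.exp (-(((m + 1 : ℝ) / Y) ^ h)) : ℂ) * ((m : ℂ) + 1) ^ (-s) =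
      (1 / (2 * π)) * ∫ y : ℝ, mel s h Y (2 + y * I) := by
  set F : ℕ → ℝ → ℂ := fun m y ↦ Complex.Gamma (2 + y * I) * (Y : ℂ) ^ ((h : ℂ) * (2 + y * I)) *
    (1 / ((m : ℂ) + 1) ^ (s + h * (2 + y * I))) with hF
  have hre : ∀ y : ℝ, 1 < (s + (h : ℂ) * (2 + (y : ℂ) * I)).re := fun y ↦ by
    simp; linarith
  have hpt : ∀ y : ℝ, mel s h Y (2 + y * I) = ∑' m, F m y := by
    intro y
    rw [mel, zeta_eq_tsum_one_div_nat_add_one_cpow (hre y), ← tsum_mul_left]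
  have hΓc : Continuous fun y : ℝ ↦ Complex.Gamma (2 + y * I) := by
    have := continuous_Gamma_line (σ := 2) (fun m h ↦ by
      have hm : (0 : ℝ) ≤ m := m.cast_nonneg; linarith)
    simpa using this
  have hcont : ∀ m, Continuous (F m) := by
    intro m
    have hm0 : ((m : ℂ) + 1) ≠ 0 := by
      have : ((m + 1 : ℝ) : ℂ) ≠ 0 := ofReal_ne_zero.2 (by positivity)
      push_cast at this; exact this
    have h1 : Continuous fun y : ℝ ↦ (Y : ℂ) ^ ((h : ℂ) * (2 + y * I)) :=
      Continuous.const_cpow (by fun_prop) (Or.inl (ofReal_ne_zero.2 hY.ne'))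
    have h2 : Continuous fun y : ℝ ↦ 1 / ((m : ℂ) + 1) ^ (s + h * (2 + y * I)) :=
      continuous_const.div (Continuous.const_cpow (by fun_prop) (Or.inl hm0))
        fun y ↦ cpow_ne_zero_iff.2 (Or.inl hm0)
    exact (hΓc.mul h1).mul h2
  have hint : ∀ m, Integrable (F m) := fun m ↦
    ((integrable_Gamma_two_line.norm.const_mul (Y ^ (2 * h) * (m + 1 : ℝ) ^ (-(s.re + 2 * h)))).mono'
      (hcont m).aestronglyMeasurable
      (Eventually.of_forall fun y ↦ by rw [hF]; dsimp only; rw [norm_term_eq hY h s m y]))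
  set LΓ : ℝ := ∫ y : ℝ, ‖Complex.Gamma (2 + y * I)‖ with hLΓ
  have hsum : Summable fun m ↦ ∫ y, ‖F m y‖ := by
    have := (summable_nat_add_one_rpow_neg hs).mul_left (Y ^ (2 * h) * LΓ)
    refine this.congr fun m ↦ ?_
    rw [hF]; dsimp only
    simp_rw [norm_term_eq hY h s m]
    rw [integral_const_mul, hLΓ]; ring
  have hval : ∀ m, ∫ y, F m y =
      2 * π * ((Real.exp (-(((m + 1 : ℝ) / Y) ^ h)) : ℂ) * ((m : ℂ) + 1) ^ (-s)) :=
    fun m ↦ integral_term hY h s m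
  have hI : ∫ y : ℝ, mel s h Y (2 + y * I) =
      2 * π * ∑' m : ℕ, (Real.exp (-(((m + 1 : ℝ) / Y) ^ h)) : ℂ) * ((m : ℂ) + 1) ^ (-s) := by
    calc ∫ y : ℝ, mel s h Y (2 + y * I) = ∫ y : ℝ, ∑' m, F m y :=
          integral_congr_ae (Eventually.of_forall hpt)
      _ = ∑' m, ∫ y, F m y := (integral_tsum_of_summable_integral_norm hint hsum).symm
      _ = ∑' m : ℕ, 2 * π * ((Real.exp (-(((m + 1 : ℝ) / Y) ^ h)) : ℂ) * ((m : ℂ) + 1) ^ (-s)) :=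
          tsum_congr hval
      _ = _ := tsum_mul_left
  rw [hI, ← mul_assoc, show (1 / (2 * (π : ℂ)) * (2 * π)) = 1 by
    field_simp, one_mul]

/-! ## §3. `D_Y` on the strip `−(k+1)/h ≤ re z ≤ 2`: poles, bounds, and the two shifts

For `re s = 1/2` the integrand `D_Y(z) = Γ(z) Y^{hz} ζ(s+hz)` has in `re z > −1` exactly two
simple poles: `z₀ = (1−s)/h` (from `ζ`, real part `1/(2h)`) and `z = 0` (from `Γ`). We shift the
line `re z = 2` first to `re z = 1/(4h)` across `z₀`, then to `re z = −(k+1)/h` across `0`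
(`HuxleyZeroDetection.integral_vertical_sub_eq_of_pole`). -/

/-- The numerator at the pole `z₀ = (1−s)/h`: `Γ(z) Y^{hz} ζ₁(s+hz)/h` (`ζ₁ = (u−1)ζ(u)` entire,
`s + hz − 1 = h(z − z₀)`). [folklore] -/
def numA (s : ℂ) (h Y : ℝ) (z : ℂ) : ℂ :=
  Complex.Gamma z * (Y : ℂ) ^ ((h : ℂ) * z) * riemannZeta₁ (s + h * z) / h

/-- The numerator at the pole `z = 0`: `Γ(z+1) Y^{hz} ζ(s+hz)`. [folklore] -/
def numB (s : ℂ) (h Y : ℝ) (z : ℂ) : ℂ :=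
  Complex.Gamma (z + 1) * (Y : ℂ) ^ ((h : ℂ) * z) * riemannZeta (s + h * z)

/-- `D_Y(z) = numA(z)/(z − z₀)` away from `z₀`. [folklore] -/
theorem mel_eq_numA_div (s : ℂ) {h : ℝ} (hh : h ≠ 0) (Y : ℝ) {z : ℂ} (hz : s + h * z ≠ 1) :
    mel s h Y z = numA s h Y z / (z - (1 - s) / h) := by
  unfold mel numA
  rw [riemannZeta_eq_inv_sub_mul hz]
  have hh' : (h : ℂ) ≠ 0 := ofReal_ne_zero.2 hh
  have hz' : s + h * z - 1 ≠ 0 := sub_ne_zero.2 hz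
  have e : (z - (1 - s) / h) = (s + h * z - 1) / h := by field_simp; ring
  rw [e]
  field_simp

/-- `D_Y(z) = numB(z)/z` away from `0`. [folklore] -/
theorem mel_eq_numB_div (s : ℂ) (h Y : ℝ) {z : ℂ} (hz : z ≠ 0) :
    mel s h Y z = numB s h Y z / (z - 0) := by
  unfold mel numB
  rw [sub_zero, Complex.Gamma_add_one _ hz]
  field_simp

/-- `numA` is holomorphic on `re z > 0`. [folklore] -/
theorem differentiableOn_numA (s : ℂ) (h : ℝ) {Y : ℝ} (hY : 0 < Y) {a b : ℝ} (ha : 0 < a) :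
    DifferentiableOn ℂ (numA s h Y) (Icc a b ×ℂ univ) := by
  intro z hz
  have hza : a ≤ z.re := (mem_reProdIm.1 hz).1.1
  apply DifferentiableAt.differentiableWithinAt
  unfold numA
  refine DifferentiableAt.div_const (((Complex.differentiableAt_Gamma z ?_).mul ?_).mul ?_) _
  · intro m hm
    have := congrArg re hm
    simp at this
    linarith [(m.cast_nonneg : (0 : ℝ) ≤ m)]
  · exact DifferentiableAt.const_cpow (by fun_prop) (Or.inl (ofReal_ne_zero.2 hY.ne'))
  · exact (differentiable_riemannZeta₁.differentiableAt).comp z (by fun_prop)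

/-- `numB` is holomorphic on `−1 < re z < 1/(2h)` (for `re s = 1/2`). [folklore] -/
theorem differentiableOn_numB {s : ℂ} (hs : s.re = 1 / 2) {h : ℝ} (hh : 0 < h) {Y : ℝ} (hY : 0 < Y)
    {a b : ℝ} (ha : -1 < a) (hb : b < 1 / (2 * h)) :
    DifferentiableOn ℂ (numB s h Y) (Icc a b ×ℂ univ) := by
  intro z hz
  obtain ⟨⟨hza, hzb⟩, -⟩ := mem_reProdIm.1 hz
  apply DifferentiableAt.differentiableWithinAt
  unfold numB
  refine ((?_ : DifferentiableAt ℂ (fun z ↦ Complex.Gamma (z + 1)) z).mul ?_).mul ?_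
  · refine (Complex.differentiableAt_Gamma (z + 1) ?_).comp z (by fun_prop)
    intro m hm
    have := congrArg re hm
    simp at this
    linarith [(m.cast_nonneg : (0 : ℝ) ≤ m)]
  · exact DifferentiableAt.const_cpow (by fun_prop) (Or.inl (ofReal_ne_zero.2 hY.ne'))
  · refine (differentiableAt_riemannZeta ?_).comp z (by fun_prop)
    intro h1
    have := congrArg re h1
    simp [hs] at this
    have hzb' : h * z.re < h * (1 / (2 * h)) := mul_lt_mul_of_pos_left (hzb.trans_lt hb) hh
    rw [show h * (1 / (2 * h)) = 1 / 2 by field_simp] at hzb'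
    linarith

/-- **Uniform bound for `D_Y` on the strip** `−(k+1)/h ≤ re z ≤ 2` (`re z ≥ −1/2`), for
`|im z| ≥ (|im s|+1)/h + 1`:
`‖D_Y(x+iy)‖ ≤ 3000 Y^{2h} (3+k+|im s|+h)^{k+4} (1+|y|)^{k+6} e^{-π|y|/2}`
(`‖Γ‖ ≤ 3(1+|y|)²e^{-π|y|/2}`, `‖Y^{hz}‖ ≤ Y^{2h}`, and `norm_zeta_le_pow_left`). [folklore] -/
theorem norm_mel_le {s : ℂ} (hs : s.re = 1 / 2) {h Y : ℝ} (hh : 1 ≤ h) (hY : 1 ≤ Y) (k : ℕ)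
    {x : ℝ} (hx1 : -((k + 1) / h) ≤ x) (hx1' : -(1 / 2 : ℝ) ≤ x) (hx2 : x ≤ 2) {y : ℝ}
    (hy : (|s.im| + 1) / h + 1 ≤ |y|) :
    ‖mel s h Y (x + y * I)‖ ≤ 3000 * Y ^ (2 * h) * (3 + k + |s.im| + h) ^ (k + 4) *
      ((1 + |y|) ^ (k + 6) * Real.exp (-(π * |y| / 2))) := by
  have hh0 : 0 < h := by linarith
  have hY0 : 0 < Y := by linarith
  have hy1 : 1 ≤ |y| := le_trans (by linarith [show (0 : ℝ) ≤ (|s.im| + 1) / h by positivity]) hy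
  have hk0 : (0 : ℝ) ≤ k := k.cast_nonneg
  have ht0 := abs_nonneg s.im
  -- Gamma
  have hΓ : ‖Complex.Gamma (x + y * I)‖ ≤ 3 * (1 + |y|) ^ 2 * Real.exp (-(π * |y| / 2)) :=
    norm_Gamma_vertical_le (by linarith) (by linarith) hy1
  -- the power of `Y`
  have hYp : ‖(Y : ℂ) ^ ((h : ℂ) * (x + y * I))‖ ≤ Y ^ (2 * h) := by
    rw [norm_cpow_ofReal_mul hY0]
    refine Real.rpow_le_rpow_of_exponent_le hY ?_
    simp; nlinarith
  -- zeta
  set u : ℂ := s + h * (x + y * I) with hu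
  have hure : u.re = 1 / 2 + h * x := by simp [hu, hs]
  have huim : u.im = s.im + h * y := by simp [hu]
  have hure' : -(1 / 2 : ℝ) - k ≤ u.re := by
    rw [hure]
    have : -(k + 1 : ℝ) ≤ h * x := by
      have := mul_le_mul_of_nonneg_left hx1 hh0.le
      rwa [show h * -((k + 1) / h) = -(k + 1 : ℝ) by field_simp] at this
    linarith
  have hhy : |s.im| + 1 + h ≤ h * |y| := by
    have := mul_le_mul_of_nonneg_left hy hh0.le
    rw [show h * ((|s.im| + 1) / h + 1) = |s.im| + 1 + h by field_simp] at this
    exact this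
  have huim' : 1 ≤ |u.im| := by
    rw [huim]
    have h1 : |h * y| - |s.im| ≤ |s.im + h * y| := by
      have := abs_sub_abs_le_abs_sub (h * y) (-s.im)
      rw [abs_neg, show h * y - -s.im = s.im + h * y by ring] at this
      exact this
    rw [abs_mul, abs_of_pos hh0] at h1
    linarith
  have hζ : ‖riemannZeta u‖ ≤ 1000 * (3 + k + |u.im|) ^ (k + 4) := norm_zeta_le_pow_left k hure' huim'
  have hbase : 3 + k + |u.im| ≤ (3 + k + |s.im| + h) * (1 + |y|) := by
    rw [huim]
    have h1 : |s.im + h * y| ≤ |s.im| + h * |y| := by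
      calc |s.im + h * y| ≤ |s.im| + |h * y| := abs_add_le _ _
        _ = |s.im| + h * |y| := by rw [abs_mul, abs_of_pos hh0]
    nlinarith [abs_nonneg y]
  have hζ' : ‖riemannZeta u‖ ≤ 1000 * ((3 + k + |s.im| + h) ^ (k + 4) * (1 + |y|) ^ (k + 4)) := by
    refine hζ.trans ?_
    rw [← mul_pow]
    gcongr
  -- assemble
  unfold mel
  rw [norm_mul, norm_mul]
  have h0a : 0 ≤ ‖Complex.Gamma (x + y * I)‖ := norm_nonneg _
  have h0b : 0 ≤ ‖(Y : ℂ) ^ ((h : ℂ) * (x + y * I))‖ := norm_nonneg _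
  calc ‖Complex.Gamma (x + y * I)‖ * ‖(Y : ℂ) ^ ((h : ℂ) * (x + y * I))‖ * ‖riemannZeta u‖
      ≤ (3 * (1 + |y|) ^ 2 * Real.exp (-(π * |y| / 2))) * Y ^ (2 * h) *
          (1000 * ((3 + k + |s.im| + h) ^ (k + 4) * (1 + |y|) ^ (k + 4))) := by
        gcongr
    _ = 3000 * Y ^ (2 * h) * (3 + k + |s.im| + h) ^ (k + 4) *
          ((1 + |y|) ^ (k + 6) * Real.exp (-(π * |y| / 2))) := by ring

/-- `y ↦ D_Y(c+iy)` is continuous when the line avoids the poles (`c ∉ −ℕ`, `1/2 + hc ≠ 1`).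
[folklore] -/
theorem continuous_mel_line {s : ℂ} (hs : s.re = 1 / 2) (h : ℝ) {Y : ℝ} (hY : 0 < Y) {c : ℝ}
    (hc : ∀ m : ℕ, c ≠ -m) (hc' : 1 / 2 + h * c ≠ 1) :
    Continuous fun y : ℝ ↦ mel s h Y (c + y * I) := by
  unfold mel
  have hΓ : Continuous fun y : ℝ ↦ Complex.Gamma (c + y * I) := continuous_Gamma_line hc
  have hYc : Continuous fun y : ℝ ↦ (Y : ℂ) ^ ((h : ℂ) * (c + y * I)) :=
    Continuous.const_cpow (by fun_prop) (Or.inl (ofReal_ne_zero.2 hY.ne'))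
  have hζ : Continuous fun y : ℝ ↦ riemannZeta (s + h * (c + y * I)) := by
    refine continuous_iff_continuousAt.2 fun y ↦ ?_
    have hne : s + h * (c + y * I) ≠ 1 := by
      intro h1
      have := congrArg re h1
      simp [hs] at this
      exact hc' (by linarith)
    have hinner : Continuous fun y : ℝ ↦ s + h * (c + y * I) := by fun_prop
    exact ContinuousAt.comp (f := fun y : ℝ ↦ s + h * (c + y * I))
      (differentiableAt_riemannZeta hne).continuousAt hinner.continuousAt
  exact (hΓ.mul hYc).mul hζ

/-- `y ↦ D_Y(c+iy)` is integrable on every admissible line of the strip. [folklore] -/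
theorem integrable_mel_line {s : ℂ} (hs : s.re = 1 / 2) {h Y : ℝ} (hh : 1 ≤ h) (hY : 1 ≤ Y) (k : ℕ)
    {c : ℝ} (hc1 : -((k + 1) / h) ≤ c) (hc1' : -(1 / 2 : ℝ) ≤ c) (hc2 : c ≤ 2)
    (hc : ∀ m : ℕ, c ≠ -m) (hc' : 1 / 2 + h * c ≠ 1) :
    Integrable fun y : ℝ ↦ mel s h Y (c + y * I) := by
  refine integrable_of_continuous_of_le (continuous_mel_line hs h (by linarith) hc hc')
    ((integrable_pow_mul_exp (k + 6)).const_mul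
      (3000 * Y ^ (2 * h) * (3 + k + |s.im| + h) ^ (k + 4)))
    (R := (|s.im| + 1) / h + 1) fun y hy ↦ ?_
  exact norm_mel_le hs hh hY k hc1 hc1' hc2 hy

/-- Uniform decay of `num(z)/(z − w₀) = D_Y(z)` at the ends of a strip, in the form required by
`integral_vertical_sub_eq_of_pole`. [folklore] -/
theorem mel_decay {s : ℂ} (hs : s.re = 1 / 2) {h Y : ℝ} (hh : 1 ≤ h) (hY : 1 ≤ Y) (k : ℕ)
    {a b : ℝ} (ha : -((k + 1) / h) ≤ a) (ha' : -(1 / 2 : ℝ) ≤ a) (hb : b ≤ 2) (num : ℂ → ℂ)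
    (w₀ : ℂ) {R₁ : ℝ}
    (hnum : ∀ z : ℂ, z.re ∈ Icc a b → R₁ ≤ |z.im| → num z / (z - w₀) = mel s h Y z) :
    ∀ ε : ℝ, 0 < ε → ∃ T₀ : ℝ, ∀ σ ∈ Icc a b, ∀ T : ℝ, T₀ ≤ |T| →
      ‖num (σ + T * I) / (σ + T * I - w₀)‖ ≤ ε := by
  intro ε hε
  set K : ℝ := 3000 * Y ^ (2 * h) * (3 + k + |s.im| + h) ^ (k + 4) with hK
  have hK0 : 0 ≤ K := by rw [hK]; positivity
  obtain ⟨T₁, hT₁⟩ := exists_pow_mul_exp_le (k + 6) hK0 hε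
  refine ⟨max (max T₁ ((|s.im| + 1) / h + 1)) R₁, fun σ hσ T hT ↦ ?_⟩
  have hT1 : T₁ ≤ |T| := le_trans (le_trans (le_max_left _ _) (le_max_left _ _)) hT
  have hT2 : (|s.im| + 1) / h + 1 ≤ |T| := le_trans (le_trans (le_max_right _ _) (le_max_left _ _)) hT
  have hT3 : R₁ ≤ |T| := le_trans (le_max_right _ _) hT
  have hz : ((σ : ℂ) + T * I).re ∈ Icc a b := by simpa using hσ
  rw [hnum _ hz (by simpa using hT3)]
  exact (norm_mel_le hs hh hY k (by linarith [hσ.1]) (by linarith [hσ.1]) (by linarith [hσ.2]) hT2).trans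
    (hT₁ T hT1)

/-- Real and imaginary parts of the points `c + iy` of a vertical line. [folklore] -/
theorem re_line (c y : ℝ) : ((c : ℂ) + y * I).re = c := by simp

/-- The imaginary part of a point of a vertical line. [folklore] -/
theorem im_line (c y : ℝ) : ((c : ℂ) + y * I).im = y := by simp

/-- **First shift: `re z = 2 → re z = 1/(4h)` across the pole `z₀ = (1−s)/h` of `ζ(s+hz)`**
(`re s = 1/2`, `h ≥ 1`, `Y ≥ 1`):
`∫ D_Y(2+iy) dy − ∫ D_Y(1/(4h)+iy) dy = 2π Γ(z₀) Y^{hz₀} ζ₁(1)/h`.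
[cite: Ivic1985, Section 4.4, proof of (4.61)] -/
theorem shift_two_quarter {s : ℂ} (hs : s.re = 1 / 2) {h Y : ℝ} (hh : 1 ≤ h) (hY : 1 ≤ Y) :
    (∫ y : ℝ, mel s h Y ((2 : ℝ) + y * I)) - (∫ y : ℝ, mel s h Y ((1 / (4 * h) : ℝ) + y * I)) =
      2 * π * numA s h Y ((1 - s) / h) := by
  have hh0 : 0 < h := by linarith
  have hY0 : 0 < Y := by linarith
  set z₀ : ℂ := (1 - s) / h with hz₀
  have hz₀re : z₀.re = 1 / (2 * h) := by
    rw [hz₀, div_ofReal_re, sub_re, one_re, hs]; ring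
  have hkey : ∀ z : ℂ, z ≠ z₀ → s + h * z ≠ 1 := by
    intro z hz h1
    apply hz
    rw [hz₀, eq_div_iff (ofReal_ne_zero.2 hh0.ne')]
    linear_combination h1
  have hnum : ∀ z : ℂ, z ≠ z₀ → numA s h Y z / (z - z₀) = mel s h Y z :=
    fun z hz ↦ (mel_eq_numA_div s hh0.ne' Y (hkey z hz)).symm
  have hne_of_re : ∀ z : ℂ, z.re ≠ 1 / (2 * h) → z ≠ z₀ := fun z hz h' ↦ hz (by rw [h', hz₀re])
  have h14 : 1 / (4 * h) ≠ 1 / (2 * h) := by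
    rw [Ne, div_eq_div_iff (by positivity) (by positivity)]; intro h'; nlinarith
  have h2 : (2 : ℝ) ≠ 1 / (2 * h) := by
    intro h'; rw [eq_div_iff (by positivity)] at h'; nlinarith
  have hq0 : 0 < 1 / (4 * h) := by positivity
  have hk1 : -((0 + 1 : ℝ) / h) ≤ 1 / (4 * h) := by
    have : 0 < (0 + 1 : ℝ) / h := by positivity
    linarith
  have hlineA : ∀ y : ℝ, ((1 / (4 * h) : ℝ) : ℂ) + y * I ≠ z₀ := fun y ↦
    hne_of_re _ (by rw [re_line]; exact h14)
  have hlineB : ∀ y : ℝ, ((2 : ℝ) : ℂ) + y * I ≠ z₀ := fun y ↦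
    hne_of_re _ (by rw [re_line]; exact h2)
  have hres := integral_vertical_sub_eq_of_pole (numA s h Y) z₀ (a := 1 / (4 * h)) (b := 2)
    (by rw [hz₀re]; rw [div_lt_div_iff₀ (by positivity) (by positivity)]; nlinarith)
    (by rw [hz₀re, div_lt_iff₀ (by positivity)]; nlinarith)
    (differentiableOn_numA s h hY0 hq0) ?_ ?_ ?_
  · rw [← hres]
    congr 1
    · exact integral_congr_ae (Eventually.of_forall fun y ↦ (hnum _ (hlineB y)).symm)
    · exact integral_congr_ae (Eventually.of_forall fun y ↦ (hnum _ (hlineA y)).symm)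
  · have hi := integrable_mel_line hs hh hY 0 (c := 1 / (4 * h)) (by simpa using hk1)
      (by linarith) (by rw [div_le_iff₀ (by positivity)]; nlinarith)
      (fun m hm ↦ by linarith [(m.cast_nonneg : (0 : ℝ) ≤ m)])
      (by rw [show h * (1 / (4 * h)) = 1 / 4 by field_simp]; norm_num)
    exact hi.congr (Eventually.of_forall fun y ↦ (hnum _ (hlineA y)).symm)
  · have hi := integrable_mel_line hs hh hY 0 (c := 2)
      (by linarith [show (0 : ℝ) < ((0 : ℕ) + 1 : ℝ) / h by positivity]) (by norm_num) le_rfl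
      (fun m hm ↦ by linarith [(m.cast_nonneg : (0 : ℝ) ≤ m)]) (by intro h'; nlinarith)
    exact hi.congr (Eventually.of_forall fun y ↦ (hnum _ (hlineB y)).symm)
  · refine mel_decay hs hh hY 0 (a := 1 / (4 * h)) (b := 2) (by simpa using hk1) (by linarith)
      le_rfl (numA s h Y) z₀ (R₁ := |z₀.im| + 1) fun z _ hzim ↦ hnum z ?_
    intro h'
    rw [h'] at hzim
    linarith

/-- `−(k+1)/h` is not a pole of `Γ` when `0 < (k+1)/h ≤ 1/2`. [folklore] -/
theorem neg_kappa_ne {κ : ℝ} (hκ0 : 0 < κ) (hκ : κ ≤ 1 / 2) (m : ℕ) : -κ ≠ -(m : ℝ) := by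
  intro hm
  have hm' : κ = m := by linarith
  rcases Nat.eq_zero_or_pos m with h0 | h0
  · subst h0; simp at hm'; linarith
  · have : (1 : ℝ) ≤ m := by exact_mod_cast h0
    linarith

/-- **Second shift: `re z = 1/(4h) → re z = −(k+1)/h` across the pole `z = 0` of `Γ(z)`**
(`re s = 1/2`, `2(k+1) ≤ h`, `Y ≥ 1`): `∫ D_Y(1/(4h)+iy) dy − ∫ D_Y(−(k+1)/h+iy) dy = 2π ζ(s)`
(residue `Γ(1) Y⁰ ζ(s)`). [cite: Ivic1985, Section 4.4, proof of (4.61)] -/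
theorem shift_quarter_left {s : ℂ} (hs : s.re = 1 / 2) (k : ℕ) {h Y : ℝ} (hh : 2 * (k + 1) ≤ h)
    (hY : 1 ≤ Y) :
    (∫ y : ℝ, mel s h Y ((1 / (4 * h) : ℝ) + y * I)) -
        (∫ y : ℝ, mel s h Y ((-((k + 1) / h) : ℝ) + y * I)) =
      2 * π * riemannZeta s := by
  have hk0 : (0 : ℝ) ≤ k := k.cast_nonneg
  have hh1 : 1 ≤ h := by linarith
  have hh0 : 0 < h := by linarith
  have hY0 : 0 < Y := by linarith
  have hκ : (k + 1) / h ≤ 1 / 2 := by rw [div_le_iff₀ hh0]; linarith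
  have hκ0 : 0 < (k + 1) / h := by positivity
  have hnum : ∀ z : ℂ, z ≠ 0 → numB s h Y z / (z - 0) = mel s h Y z :=
    fun z hz ↦ (mel_eq_numB_div s h Y hz).symm
  have hne_of_re : ∀ z : ℂ, z.re ≠ 0 → z ≠ 0 := fun z hz h' ↦ hz (by rw [h']; simp)
  have hq0 : 0 < 1 / (4 * h) := by positivity
  have hq : 1 / (4 * h) < 1 / (2 * h) := by
    rw [div_lt_div_iff₀ (by positivity) (by positivity)]; nlinarith
  have hB0 : numB s h Y 0 = riemannZeta s := by
    simp [numB, Complex.Gamma_one]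
  have hlineA : ∀ y : ℝ, ((-((k + 1) / h) : ℝ) : ℂ) + y * I ≠ 0 := fun y ↦
    hne_of_re _ (by rw [re_line]; linarith)
  have hlineB : ∀ y : ℝ, ((1 / (4 * h) : ℝ) : ℂ) + y * I ≠ 0 := fun y ↦
    hne_of_re _ (by rw [re_line]; exact hq0.ne')
  have hres := integral_vertical_sub_eq_of_pole (numB s h Y) 0 (a := -((k + 1) / h))
    (b := 1 / (4 * h)) (by simp; exact hκ0) (by simpa using hq0)
    (differentiableOn_numB hs hh0 hY0 (by linarith) hq) ?_ ?_ ?_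
  · rw [hB0] at hres
    rw [← hres]
    congr 1
    · exact integral_congr_ae (Eventually.of_forall fun y ↦ (hnum _ (hlineB y)).symm)
    · exact integral_congr_ae (Eventually.of_forall fun y ↦ (hnum _ (hlineA y)).symm)
  · have hi := integrable_mel_line hs hh1 hY k (c := -((k + 1) / h)) le_rfl (by linarith)
      (by linarith) (neg_kappa_ne hκ0 hκ)
      (by rw [show h * -((k + 1) / h) = -(k + 1 : ℝ) by field_simp]; intro h'; linarith)
    exact hi.congr (Eventually.of_forall fun y ↦ (hnum _ (hlineA y)).symm)
  · have hk1 : -((k + 1 : ℝ) / h) ≤ 1 / (4 * h) := by linarith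
    have hi := integrable_mel_line hs hh1 hY k (c := 1 / (4 * h)) hk1 (by linarith)
      (by rw [div_le_iff₀ (by positivity)]; nlinarith)
      (fun m hm ↦ by linarith [(m.cast_nonneg : (0 : ℝ) ≤ m)])
      (by rw [show h * (1 / (4 * h)) = 1 / 4 by field_simp]; norm_num)
    exact hi.congr (Eventually.of_forall fun y ↦ (hnum _ (hlineB y)).symm)
  · refine mel_decay hs hh1 hY k (a := -((k + 1) / h)) (b := 1 / (4 * h)) le_rfl (by linarith)
      (by rw [div_le_iff₀ (by positivity)]; nlinarith) (numB s h Y) 0 (R₁ := 1)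
      fun z _ hzim ↦ hnum z ?_
    intro h'
    rw [h'] at hzim
    simp at hzim
    linarith

/-! ## §4. The functional equation on `re z = −(k+1)/h` and the tail of the reflected series

On the left line `u = s + hz` has `re u = −1/2 − k`, and `ζ(u) = F(1−u)ζ(1−u)` with
`ζ(1−u) = ∑_{n≤M} n^{-(1−u)} + ∑_{n>M} n^{-(1−u)}` absolutely convergent (`re(1−u) = 3/2 + k`).
The tail is estimated on this line (Ivić estimates it on `re(s+w) = −h/2` instead). -/

/-- The reflected Dirichlet polynomial `A_M(v) = ∑_{n≤M} n^{-v}`. [cite: Ivic1985, Section 4.4 (4.62)] -/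
def dirA (M : ℕ) (v : ℂ) : ℂ := ∑ n ∈ Finset.range M, 1 / ((n : ℂ) + 1) ^ v

/-- The tail `R_M(v) = ∑_{n>M} n^{-v}` of the reflected Dirichlet series.
[cite: Ivic1985, Section 4.4 (4.63)] -/
def dirR (M : ℕ) (v : ℂ) : ℂ := ∑' n : ℕ, 1 / (((n + M : ℕ) : ℂ) + 1) ^ v

/-- The constant `S₀ = ∑_{n≥1} n^{-5/4}`. [folklore] -/
def S0 : ℝ := ∑' n : ℕ, ((n : ℝ) + 1) ^ (-(5 / 4 : ℝ))

/-- `S₀ ≥ 0`. [folklore] -/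
theorem S0_nonneg : 0 ≤ S0 := tsum_nonneg fun n ↦ by positivity

/-- Summability of `∑ (n+1)^{-v}` for `re v > 1`, in the `n + 1` form. [folklore] -/
theorem summable_one_div_nat_add_one_cpow {v : ℂ} (hv : 1 < v.re) :
    Summable fun n : ℕ ↦ 1 / ((n : ℂ) + 1) ^ v := by
  have h := (summable_nat_add_iff 1).2 (Complex.summable_one_div_nat_cpow.2 hv)
  refine h.congr fun n ↦ ?_
  push_cast
  rfl

/-- `ζ(v) = A_M(v) + R_M(v)` for `re v > 1`. [folklore] -/
theorem zeta_eq_dirA_add_dirR {v : ℂ} (hv : 1 < v.re) (M : ℕ) :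
    riemannZeta v = dirA M v + dirR M v := by
  rw [zeta_eq_tsum_one_div_nat_add_one_cpow hv, dirA, dirR]
  exact ((summable_one_div_nat_add_one_cpow hv).sum_add_tsum_nat_add M).symm

/-- `A_M` as a sum over `1 ≤ m ≤ M`: `A_M(v) = ∑_{m ∈ [1, M]} m^{-v}`. [folklore] -/
theorem dirA_eq_sum_Icc (M : ℕ) (v : ℂ) :
    dirA M v = ∑ m ∈ Finset.Icc 1 M, (m : ℂ) ^ (-v) := by
  unfold dirA
  have e : ∀ n ∈ Finset.range M, 1 / ((n : ℂ) + 1) ^ v = (((n + 1 : ℕ)) : ℂ) ^ (-v) := by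
    intro n _
    rw [Complex.cpow_neg, one_div]
    push_cast
    rfl
  rw [Finset.sum_congr rfl e, Finset.range_eq_Ico,
    Finset.sum_Ico_add' (fun m : ℕ ↦ (m : ℂ) ^ (-v)) 0 M 1, zero_add]
  have hI : Finset.Ico 1 (M + 1) = Finset.Icc 1 M := by ext m; simp
  rw [hI]

/-- `‖A_M(v)‖ ≤ M` for `re v ≥ 0`. [folklore] -/
theorem norm_dirA_le (M : ℕ) {v : ℂ} (hv : 0 ≤ v.re) : ‖dirA M v‖ ≤ M := by
  unfold dirA
  calc ‖∑ n ∈ Finset.range M, 1 / ((n : ℂ) + 1) ^ v‖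
      ≤ ∑ n ∈ Finset.range M, ‖1 / ((n : ℂ) + 1) ^ v‖ := norm_sum_le _ _
    _ ≤ ∑ _n ∈ Finset.range M, (1 : ℝ) := Finset.sum_le_sum fun n _ ↦ by
        have hn : (0 : ℝ) < n + 1 := by positivity
        rw [norm_div, norm_one, show ((n : ℂ) + 1) = ((n + 1 : ℝ) : ℂ) by push_cast; ring,
          Complex.norm_cpow_eq_rpow_re_of_pos hn, one_div]
        exact inv_le_one_of_one_le₀ (Real.one_le_rpow (by linarith) hv)
    _ = M := by simp

/-- `A_M` is entire. [folklore] -/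
theorem differentiable_dirA (M : ℕ) : Differentiable ℂ (dirA M) := by
  have e : dirA M = fun v ↦ ∑ n ∈ Finset.range M, 1 / ((n : ℂ) + 1) ^ v := rfl
  rw [e]
  refine Differentiable.fun_sum fun n _ ↦ ?_
  have hn0 : ((n : ℂ) + 1) ≠ 0 := by
    have : ((n + 1 : ℝ) : ℂ) ≠ 0 := ofReal_ne_zero.2 (by positivity)
    push_cast at this; exact this
  intro v
  exact (differentiableAt_const _).div (DifferentiableAt.const_cpow differentiableAt_id
    (Or.inl hn0)) (cpow_ne_zero_iff.2 (Or.inl hn0))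

/-- **The tail of the reflected series on `re v = 3/2 + k`**:
`‖R_M(v)‖ ≤ S₀ (M+1)^{-(k+1/4)}` (`n^{-(3/2+k)} ≤ (M+1)^{-(k+1/4)} · n'^{-5/4}` for
`n = n' + M ≥ M + 1`). [folklore] -/
theorem norm_dirR_le (k M : ℕ) {v : ℂ} (hv : v.re = 3 / 2 + k) :
    ‖dirR M v‖ ≤ S0 * ((M : ℝ) + 1) ^ (-((k : ℝ) + 1 / 4)) := by
  have hk0 : (0 : ℝ) ≤ k := k.cast_nonneg
  have hv1 : 1 < v.re := by rw [hv]; linarith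
  have hsum := (summable_nat_add_iff M).2 (summable_one_div_nat_add_one_cpow hv1)
  have hterm : ∀ n : ℕ, ‖1 / (((n + M : ℕ) : ℂ) + 1) ^ v‖ ≤
      ((M : ℝ) + 1) ^ (-((k : ℝ) + 1 / 4)) * ((n : ℝ) + 1) ^ (-(5 / 4 : ℝ)) := by
    intro n
    have hx : (0 : ℝ) < (n + M : ℕ) + 1 := by positivity
    rw [norm_div, norm_one, show (((n + M : ℕ) : ℂ) + 1) = ((((n + M : ℕ) : ℝ) + 1 : ℝ) : ℂ) by
      push_cast; ring, Complex.norm_cpow_eq_rpow_re_of_pos hx, hv, one_div,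
      ← Real.rpow_neg hx.le]
    have hsplit : (((n + M : ℕ) : ℝ) + 1) ^ (-(3 / 2 + (k : ℝ))) =
        (((n + M : ℕ) : ℝ) + 1) ^ (-((k : ℝ) + 1 / 4)) * (((n + M : ℕ) : ℝ) + 1) ^ (-(5 / 4 : ℝ)) := by
      rw [← Real.rpow_add hx]; congr 1; ring
    rw [hsplit]
    refine mul_le_mul ?_ ?_ (by positivity) (by positivity)
    · exact Real.rpow_le_rpow_of_nonpos (by positivity) (by push_cast; linarith) (by linarith)
    · exact Real.rpow_le_rpow_of_nonpos (by positivity) (by push_cast; linarith) (by norm_num)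
  have hmaj : Summable fun n : ℕ ↦ ((M : ℝ) + 1) ^ (-((k : ℝ) + 1 / 4)) * ((n : ℝ) + 1) ^ (-(5 / 4 : ℝ)) :=
    (summable_nat_add_one_rpow_neg (by norm_num : (1 : ℝ) < 5 / 4)).mul_left _
  unfold dirR
  calc ‖∑' n : ℕ, 1 / (((n + M : ℕ) : ℂ) + 1) ^ v‖ ≤ ∑' n : ℕ, ‖1 / (((n + M : ℕ) : ℂ) + 1) ^ v‖ :=
        norm_tsum_le_tsum_norm hsum.norm
    _ ≤ ∑' n : ℕ, ((M : ℝ) + 1) ^ (-((k : ℝ) + 1 / 4)) * ((n : ℝ) + 1) ^ (-(5 / 4 : ℝ)) :=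
        Summable.tsum_le_tsum hterm hsum.norm hmaj
    _ = S0 * ((M : ℝ) + 1) ^ (-((k : ℝ) + 1 / 4)) := by rw [tsum_mul_left, S0, mul_comm]

/-- The finite part of `D_Y` after the functional equation:
`E_Y(z) = Γ(z) Y^{hz} F(1−s−hz) A_M(1−s−hz)`. [cite: Ivic1985, Section 4.4 (4.62)] -/
def finE (s : ℂ) (h Y : ℝ) (M : ℕ) (z : ℂ) : ℂ :=
  Complex.Gamma z * (Y : ℂ) ^ ((h : ℂ) * z) * feFactor (1 - s - h * z) * dirA M (1 - s - h * z)

/-- The tail part of `D_Y` after the functional equation: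
`T_Y(z) = Γ(z) Y^{hz} F(1−s−hz) R_M(1−s−hz)`. [cite: Ivic1985, Section 4.4 (4.63)] -/
def tailT (s : ℂ) (h Y : ℝ) (M : ℕ) (z : ℂ) : ℂ :=
  Complex.Gamma z * (Y : ℂ) ^ ((h : ℂ) * z) * feFactor (1 - s - h * z) * dirR M (1 - s - h * z)

/-- **The functional equation on the left line**: for `re s = 1/2` and `re z = −(k+1)/h`,
`D_Y(z) = E_Y(z) + T_Y(z)`. [cite: Ivic1985, Section 4.4 (4.61)–(4.63)] -/
theorem mel_eq_finE_add_tailT {s : ℂ} (hs : s.re = 1 / 2) (k : ℕ) {h : ℝ} (hh : 0 < h) (Y : ℝ)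
    (M : ℕ) (y : ℝ) :
    mel s h Y ((-((k + 1) / h) : ℝ) + y * I) =
      finE s h Y M ((-((k + 1) / h) : ℝ) + y * I) + tailT s h Y M ((-((k + 1) / h) : ℝ) + y * I) := by
  set z : ℂ := ((-((k + 1) / h) : ℝ) : ℂ) + y * I with hz
  set u : ℂ := s + h * z with hu
  have hk0 : (0 : ℝ) ≤ k := k.cast_nonneg
  have hure : u.re = -(1 / 2) - k := by
    rw [hu, hz]; simp [hs]; field_simp; ring
  have hu0 : u ≠ 0 := fun h0 ↦ by
    have := congrArg re h0; rw [hure] at this; simp at this; linarith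
  have hun : ∀ n : ℕ, u ≠ 1 + n := fun n hn ↦ by
    have := congrArg re hn; rw [hure] at this; simp at this; linarith [(n.cast_nonneg : (0 : ℝ) ≤ n)]
  have h1u : 1 < (1 - u).re := by rw [sub_re, one_re, hure]; linarith
  unfold mel finE tailT
  rw [riemannZeta_eq_feFactor_mul hun hu0, zeta_eq_dirA_add_dirR h1u M,
    show (1 - u) = 1 - s - h * z by rw [hu]; ring]
  ring

/-- **The tail integral `J₂`** on `re z = −(k+1)/h` (`re s = 1/2`, `2(k+1) ≤ h`, `Y ≥ 1`):
pointwise, `‖T_Y(z)‖ ≤ 384π²S₀ · (h/(k+1)) · (3+k+|im s|+h)^{k+3} · Y^{-(k+1)} (M+1)^{-(k+1/4)}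
· (1+|y|)^{k+5} e^{-π|y|/2}`. [cite: Ivic1985, Section 4.4, proof of (4.64)] -/
theorem norm_tailT_le {s : ℂ} (hs : s.re = 1 / 2) (k : ℕ) {h : ℝ} (hh : 2 * (k + 1) ≤ h) {Y : ℝ}
    (hY : 1 ≤ Y) (M : ℕ) (y : ℝ) :
    ‖tailT s h Y M ((-((k + 1) / h) : ℝ) + y * I)‖ ≤
      (384 * π ^ 2 * S0 * (h / (k + 1)) * (3 + k + |s.im| + h) ^ (k + 3) *
        Y ^ (-((k : ℝ) + 1)) * ((M : ℝ) + 1) ^ (-((k : ℝ) + 1 / 4))) *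
        ((1 + |y|) ^ (k + 5) * Real.exp (-(π * |y| / 2))) := by
  have hk0 : (0 : ℝ) ≤ k := k.cast_nonneg
  have hh0 : 0 < h := by linarith
  have hY0 : 0 < Y := by linarith
  have hκ : (k + 1) / h ≤ 1 / 2 := by rw [div_le_iff₀ hh0]; linarith
  have hκ0 : 0 < (k + 1) / h := by positivity
  set z : ℂ := ((-((k + 1) / h) : ℝ) : ℂ) + y * I with hz
  set v : ℂ := 1 - s - h * z with hv
  have hvre : v.re = 3 / 2 + k := by
    rw [hv, hz]; simp [hs]; field_simp; ring
  have hvim : v.im = -(s.im + h * y) := by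
    rw [hv, hz]; simp; ring
  -- Gamma
  have hΓ : ‖Complex.Gamma z‖ ≤ 12 / ((k + 1) / h) * (1 + |y|) ^ 2 * Real.exp (-(π * |y| / 2)) := by
    have := norm_Gamma_neg_line_le_exp hκ0 hκ y
    rw [hz]; push_cast at this ⊢; exact this
  -- power of Y
  have hYp : ‖(Y : ℂ) ^ ((h : ℂ) * z)‖ = Y ^ (-((k : ℝ) + 1)) := by
    rw [norm_cpow_ofReal_mul hY0, hz, re_line]; congr 1; field_simp
  -- F
  have hF : ‖feFactor v‖ ≤ 32 * π ^ 2 * ((3 + k + |s.im| + h) * (1 + |y|)) ^ (k + 3) := by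
    have e : v = ((3 / 2 + k : ℝ) : ℂ) + ((-(s.im + h * y) : ℝ) : ℂ) * I := by
      apply Complex.ext
      · simp [hvre]
      · simp [hvim]
    rw [e]
    refine (norm_feFactor_le_pow k (by linarith) (by linarith) _).trans ?_
    gcongr
    rw [abs_neg]
    calc 3 + k + |s.im + h * y| ≤ 3 + k + (|s.im| + h * |y|) := by
          gcongr
          calc |s.im + h * y| ≤ |s.im| + |h * y| := abs_add_le _ _
            _ = |s.im| + h * |y| := by rw [abs_mul, abs_of_pos hh0]
      _ ≤ (3 + k + |s.im| + h) * (1 + |y|) := by nlinarith [abs_nonneg y, abs_nonneg s.im]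
  -- tail
  have hR : ‖dirR M v‖ ≤ S0 * ((M : ℝ) + 1) ^ (-((k : ℝ) + 1 / 4)) := norm_dirR_le k M hvre
  unfold tailT
  rw [norm_mul, norm_mul, norm_mul, hYp]
  have h12 : 12 / ((k + 1) / h) = 12 * (h / (k + 1)) := by field_simp
  rw [h12] at hΓ
  calc ‖Complex.Gamma z‖ * Y ^ (-((k : ℝ) + 1)) * ‖feFactor v‖ * ‖dirR M v‖
      ≤ (12 * (h / (k + 1)) * (1 + |y|) ^ 2 * Real.exp (-(π * |y| / 2))) * Y ^ (-((k : ℝ) + 1)) *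
          (32 * π ^ 2 * ((3 + k + |s.im| + h) * (1 + |y|)) ^ (k + 3)) *
          (S0 * ((M : ℝ) + 1) ^ (-((k : ℝ) + 1 / 4))) := by
        gcongr
    _ = _ := by rw [mul_pow]; ring

/-- The resulting bound for `∫ ‖T_Y‖`:
`∫ ‖T_Y(−(k+1)/h + iy)‖ dy ≤ 768π²S₀ (2k+12)^{k+5} (h/(k+1)) (3+k+|im s|+h)^{k+3} Y^{-(k+1)} (M+1)^{-(k+1/4)}`.
[cite: Ivic1985, Section 4.4, (4.64)] -/
theorem integral_norm_tailT_le {s : ℂ} (hs : s.re = 1 / 2) (k : ℕ) {h : ℝ} (hh : 2 * (k + 1) ≤ h)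
    {Y : ℝ} (hY : 1 ≤ Y) (M : ℕ) :
    ∫ y : ℝ, ‖tailT s h Y M ((-((k + 1) / h) : ℝ) + y * I)‖ ≤
      (384 * π ^ 2 * S0 * (h / (k + 1)) * (3 + k + |s.im| + h) ^ (k + 3) *
        Y ^ (-((k : ℝ) + 1)) * ((M : ℝ) + 1) ^ (-((k : ℝ) + 1 / 4))) * (2 * (2 * (k + 5 : ℕ) + 2) ^ (k + 5)) := by
  have hk0 : (0 : ℝ) ≤ k := k.cast_nonneg
  have hh0 : 0 < h := by linarith
  set K : ℝ := 384 * π ^ 2 * S0 * (h / (k + 1)) * (3 + k + |s.im| + h) ^ (k + 3) *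
        Y ^ (-((k : ℝ) + 1)) * ((M : ℝ) + 1) ^ (-((k : ℝ) + 1 / 4)) with hK
  have hK0 : 0 ≤ K := by rw [hK]; have := S0_nonneg; positivity
  calc ∫ y : ℝ, ‖tailT s h Y M ((-((k + 1) / h) : ℝ) + y * I)‖
      ≤ ∫ y : ℝ, K * ((1 + |y|) ^ (k + 5) * Real.exp (-(π * |y| / 2))) :=
        integral_mono_of_nonneg (Eventually.of_forall fun y ↦ norm_nonneg _)
          ((integrable_pow_mul_exp (k + 5)).const_mul K)
          (Eventually.of_forall fun y ↦ norm_tailT_le hs k hh hY M y)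
    _ = K * ∫ y : ℝ, (1 + |y|) ^ (k + 5) * Real.exp (-(π * |y| / 2)) := integral_const_mul _ _
    _ ≤ K * (2 * (2 * (k + 5 : ℕ) + 2) ^ (k + 5)) :=
        mul_le_mul_of_nonneg_left (integral_pow_mul_exp_le (k + 5)) hK0

/-- `y ↦ E_Y(c+iy)` is continuous for `−1 < c < 0` with `1/2 − hc > 0`. [folklore] -/
theorem finE_continuous_aux {s : ℂ} (hs : s.re = 1 / 2) (h : ℝ) {Y : ℝ} (hY : 0 < Y) (M : ℕ)
    {c : ℝ} (hc1 : -1 < c) (hc2 : c < 0) (hpos : 0 < 1 / 2 - h * c) :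
    Continuous fun y : ℝ ↦ finE s h Y M (c + y * I) := by
  unfold finE
  have hc : ∀ m : ℕ, c ≠ -m := by
    intro m hm
    rcases Nat.eq_zero_or_pos m with h0 | h0
    · subst h0; simp at hm; linarith
    · have : (1 : ℝ) ≤ m := by exact_mod_cast h0
      linarith
  have hΓ : Continuous fun y : ℝ ↦ Complex.Gamma (c + y * I) := continuous_Gamma_line hc
  have hYc : Continuous fun y : ℝ ↦ (Y : ℂ) ^ ((h : ℂ) * (c + y * I)) :=
    Continuous.const_cpow (by fun_prop) (Or.inl (ofReal_ne_zero.2 hY.ne'))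
  have hv : Continuous fun y : ℝ ↦ 1 - s - h * (c + y * I) := by fun_prop
  have hF : Continuous fun y : ℝ ↦ feFactor (1 - s - h * (c + y * I)) := by
    refine continuous_iff_continuousAt.2 fun y ↦ ?_
    have hne : ∀ m : ℕ, 1 - s - h * (c + y * I) ≠ -m := by
      intro m hm
      have := congrArg re hm
      simp [hs] at this
      linarith [(m.cast_nonneg : (0 : ℝ) ≤ m)]
    exact ContinuousAt.comp (f := fun y : ℝ ↦ 1 - s - h * (c + y * I))
      (differentiableAt_feFactor hne).continuousAt hv.continuousAt
  have hA : Continuous fun y : ℝ ↦ dirA M (1 - s - h * (c + y * I)) :=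
    (differentiable_dirA M).continuous.comp hv
  exact ((hΓ.mul hYc).mul hF).mul hA

/-! ## §5. The finite part `E_Y` on the strip `−(k+1)/h ≤ re z ≤ −δ/h`

`E_Y` is holomorphic there (no pole of `Γ(z)`, `F(1−s−hz)` or `A_M` is met), so its integral may
be moved up to the line `re z = −δ/h`, i.e. `re(s+w) = 1/2 − δ` (Ivić: `re(s+w) = α = 1/2`; the
`δ > 0` keeps the line off the pole of `w^{-1}`, here of `Γ(z)`, at the origin). -/

/-- **Uniform bound for `E_Y` on the strip** `−(k+1)/h ≤ re z ≤ 0`, `|im z| ≥ 1`: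
`‖E_Y(x+iy)‖ ≤ 96π² M (3+k+|im s|+h)^{k+3} (1+|y|)^{k+5} e^{-π|y|/2}`. [folklore] -/
theorem norm_finE_le {s : ℂ} (hs : s.re = 1 / 2) (k : ℕ) {h : ℝ} (hh : 2 * (k + 1) ≤ h) {Y : ℝ}
    (hY : 1 ≤ Y) (M : ℕ) {x : ℝ} (hx1 : -((k + 1) / h) ≤ x) (hx2 : x ≤ 0) {y : ℝ} (hy : 1 ≤ |y|) :
    ‖finE s h Y M (x + y * I)‖ ≤ 96 * π ^ 2 * M * (3 + k + |s.im| + h) ^ (k + 3) *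
      ((1 + |y|) ^ (k + 5) * Real.exp (-(π * |y| / 2))) := by
  have hk0 : (0 : ℝ) ≤ k := k.cast_nonneg
  have hh0 : 0 < h := by linarith
  have hY0 : 0 < Y := by linarith
  have hκ : (k + 1) / h ≤ 1 / 2 := by rw [div_le_iff₀ hh0]; linarith
  have hx1' : -(1 / 2 : ℝ) ≤ x := by linarith
  have hhx : -(k + 1 : ℝ) ≤ h * x := by
    have := mul_le_mul_of_nonneg_left hx1 hh0.le
    rwa [show h * -((k + 1) / h) = -(k + 1 : ℝ) by field_simp] at this
  have hhx0 : h * x ≤ 0 := mul_nonpos_of_nonneg_of_nonpos hh0.le hx2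
  set z : ℂ := (x : ℂ) + y * I with hz
  set v : ℂ := 1 - s - h * z with hv
  have hvre : v.re = 1 / 2 - h * x := by rw [hv, hz]; simp [hs]; ring
  have hvim : v.im = -(s.im + h * y) := by rw [hv, hz]; simp; ring
  have hΓ : ‖Complex.Gamma z‖ ≤ 3 * (1 + |y|) ^ 2 * Real.exp (-(π * |y| / 2)) :=
    norm_Gamma_vertical_le (by linarith) (by linarith) hy
  have hYp : ‖(Y : ℂ) ^ ((h : ℂ) * z)‖ ≤ 1 := by
    rw [norm_cpow_ofReal_mul hY0, hz, re_line]
    exact Real.rpow_le_one_of_one_le_of_nonpos hY hhx0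
  have hF : ‖feFactor v‖ ≤ 32 * π ^ 2 * ((3 + k + |s.im| + h) * (1 + |y|)) ^ (k + 3) := by
    have e : v = ((1 / 2 - h * x : ℝ) : ℂ) + ((-(s.im + h * y) : ℝ) : ℂ) * I := by
      apply Complex.ext
      · simp [hvre]
      · simp [hvim]
    rw [e]
    refine (norm_feFactor_le_pow k (by linarith) (by linarith) _).trans ?_
    gcongr
    rw [abs_neg]
    calc 3 + k + |s.im + h * y| ≤ 3 + k + (|s.im| + h * |y|) := by
          gcongr
          calc |s.im + h * y| ≤ |s.im| + |h * y| := abs_add_le _ _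
            _ = |s.im| + h * |y| := by rw [abs_mul, abs_of_pos hh0]
      _ ≤ (3 + k + |s.im| + h) * (1 + |y|) := by nlinarith [abs_nonneg y, abs_nonneg s.im]
  have hA : ‖dirA M v‖ ≤ M := norm_dirA_le M (by rw [hvre]; linarith)
  unfold finE
  rw [norm_mul, norm_mul, norm_mul]
  calc ‖Complex.Gamma z‖ * ‖(Y : ℂ) ^ ((h : ℂ) * z)‖ * ‖feFactor v‖ * ‖dirA M v‖
      ≤ (3 * (1 + |y|) ^ 2 * Real.exp (-(π * |y| / 2))) * 1 *
          (32 * π ^ 2 * ((3 + k + |s.im| + h) * (1 + |y|)) ^ (k + 3)) * M := by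
        gcongr
    _ = _ := by rw [mul_pow]; ring

/-- `E_Y` is integrable on the lines `re z = c`, `−(k+1)/h ≤ c < 0`. [folklore] -/
theorem integrable_finE_line {s : ℂ} (hs : s.re = 1 / 2) (k : ℕ) {h : ℝ} (hh : 2 * (k + 1) ≤ h)
    {Y : ℝ} (hY : 1 ≤ Y) (M : ℕ) {c : ℝ} (hc1 : -((k + 1) / h) ≤ c) (hc2 : c < 0) :
    Integrable fun y : ℝ ↦ finE s h Y M (c + y * I) := by
  have hk0 : (0 : ℝ) ≤ k := k.cast_nonneg
  have hh0 : 0 < h := by linarith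
  have hκ : (k + 1) / h ≤ 1 / 2 := by rw [div_le_iff₀ hh0]; linarith
  have hpos : 0 < 1 / 2 - h * c := by nlinarith
  refine integrable_of_continuous_of_le (finE_continuous_aux hs h (by linarith) M (by linarith) hc2 hpos)
    ((integrable_pow_mul_exp (k + 5)).const_mul (96 * π ^ 2 * M * (3 + k + |s.im| + h) ^ (k + 3)))
    (R := 1) fun y hy ↦ norm_finE_le hs k hh hY M hc1 hc2.le hy

/-- `T_Y` is integrable on the left line (it is `D_Y − E_Y` there). [folklore] -/
theorem integrable_tailT_line {s : ℂ} (hs : s.re = 1 / 2) (k : ℕ) {h : ℝ} (hh : 2 * (k + 1) ≤ h)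
    {Y : ℝ} (hY : 1 ≤ Y) (M : ℕ) :
    Integrable fun y : ℝ ↦ tailT s h Y M ((-((k + 1) / h) : ℝ) + y * I) := by
  have hk0 : (0 : ℝ) ≤ k := k.cast_nonneg
  have hh1 : 1 ≤ h := by linarith
  have hh0 : 0 < h := by linarith
  have hκ : (k + 1) / h ≤ 1 / 2 := by rw [div_le_iff₀ hh0]; linarith
  have hκ0 : 0 < (k + 1) / h := by positivity
  have hmel := integrable_mel_line hs hh1 hY k (c := -((k + 1) / h)) le_rfl (by linarith)
    (by linarith) (neg_kappa_ne hκ0 hκ)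
    (by rw [show h * -((k + 1) / h) = -(k + 1 : ℝ) by field_simp]; intro h'; linarith)
  have hE := integrable_finE_line hs k hh hY M (c := -((k + 1) / h)) le_rfl (by linarith)
  refine (hmel.sub hE).congr (Eventually.of_forall fun y ↦ ?_)
  simp only [Pi.sub_apply, mel_eq_finE_add_tailT hs k hh0 Y M y, add_sub_cancel_left]

/-- `E_Y` is holomorphic on the strip `−(k+1)/h ≤ re z ≤ −δ/h`. [folklore] -/
theorem differentiableAt_finE {s : ℂ} (hs : s.re = 1 / 2) (h : ℝ) {Y : ℝ} (hY : 0 < Y) (M : ℕ)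
    {z : ℂ} (hz1 : -1 < z.re) (hz2 : z.re < 0) (hpos : 0 < 1 / 2 - h * z.re) :
    DifferentiableAt ℂ (finE s h Y M) z := by
  unfold finE
  have hΓ : DifferentiableAt ℂ Complex.Gamma z := by
    refine Complex.differentiableAt_Gamma z fun m hm ↦ ?_
    have := congrArg re hm
    simp at this
    rcases Nat.eq_zero_or_pos m with h0 | h0
    · subst h0; simp at this; linarith
    · have : (1 : ℝ) ≤ m := by exact_mod_cast h0
      linarith
  have hYd : DifferentiableAt ℂ (fun z ↦ (Y : ℂ) ^ ((h : ℂ) * z)) z :=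
    DifferentiableAt.const_cpow (by fun_prop) (Or.inl (ofReal_ne_zero.2 hY.ne'))
  have hF : DifferentiableAt ℂ (fun z ↦ feFactor (1 - s - h * z)) z := by
    have hne : ∀ m : ℕ, 1 - s - h * z ≠ -m := by
      intro m hm
      have := congrArg re hm
      simp [hs] at this
      linarith [(m.cast_nonneg : (0 : ℝ) ≤ m)]
    have h1 : DifferentiableAt ℂ (fun z : ℂ ↦ 1 - s - (h : ℂ) * z) z := by fun_prop
    exact (differentiableAt_feFactor hne).comp z h1
  have hA : DifferentiableAt ℂ (fun z ↦ dirA M (1 - s - h * z)) z :=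
    ((differentiable_dirA M).differentiableAt).comp z (by fun_prop)
  exact ((hΓ.mul hYd).mul hF).mul hA

/-- **Third shift: `E_Y` from `re z = −(k+1)/h` up to `re z = −δ/h`** (`0 < δ ≤ 1/2`), with no
residue. [cite: Ivic1985, Section 4.4 (4.65)] -/
theorem shift_finE {s : ℂ} (hs : s.re = 1 / 2) (k : ℕ) {h : ℝ} (hh : 2 * (k + 1) ≤ h) {Y : ℝ}
    (hY : 1 ≤ Y) (M : ℕ) {δ : ℝ} (hδ0 : 0 < δ) (hδ : δ ≤ 1 / 2) :
    ∫ y : ℝ, finE s h Y M ((-(δ / h) : ℝ) + y * I) =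
      ∫ y : ℝ, finE s h Y M ((-((k + 1) / h) : ℝ) + y * I) := by
  have hk0 : (0 : ℝ) ≤ k := k.cast_nonneg
  have hh0 : 0 < h := by linarith
  have hY0 : 0 < Y := by linarith
  have hκ : (k + 1) / h ≤ 1 / 2 := by rw [div_le_iff₀ hh0]; linarith
  have hκ0 : 0 < (k + 1) / h := by positivity
  have hκ₂0 : 0 < δ / h := by positivity
  have hκ₂ : δ / h < (k + 1) / h := by
    rw [div_lt_div_iff_of_pos_right hh0]; linarith
  set a : ℝ := -((k + 1) / h) with ha
  set b : ℝ := -(δ / h) with hb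
  set w₁ : ℂ := (((a + b) / 2 : ℝ) : ℂ) with hw₁
  have hw₁re : w₁.re = (a + b) / 2 := by rw [hw₁]; simp
  have hw₁im : w₁.im = 0 := by rw [hw₁]; simp
  have hab : a < b := by rw [ha, hb]; linarith
  set num : ℂ → ℂ := fun z ↦ (z - w₁) * finE s h Y M z with hnum
  have hnumw : num w₁ = 0 := by simp [hnum]
  have hF : ∀ z : ℂ, z ≠ w₁ → num z / (z - w₁) = finE s h Y M z := by
    intro z hz
    rw [hnum]; dsimp only
    exact mul_div_cancel_left₀ _ (sub_ne_zero.2 hz)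
  have hne_of_re : ∀ z : ℂ, z.re ≠ (a + b) / 2 → z ≠ w₁ := fun z hz h' ↦ hz (by rw [h', hw₁re])
  have hlineA : ∀ y : ℝ, ((a : ℝ) : ℂ) + y * I ≠ w₁ := fun y ↦
    hne_of_re _ (by rw [re_line]; linarith)
  have hlineB : ∀ y : ℝ, ((b : ℝ) : ℂ) + y * I ≠ w₁ := fun y ↦
    hne_of_re _ (by rw [re_line]; linarith)
  have hdiff : DifferentiableOn ℂ num (Icc a b ×ℂ univ) := by
    intro z hz
    obtain ⟨⟨hza, hzb⟩, -⟩ := mem_reProdIm.1 hz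
    apply DifferentiableAt.differentiableWithinAt
    refine DifferentiableAt.mul (by fun_prop) (differentiableAt_finE hs h hY0 M ?_ ?_ ?_)
    · rw [ha] at hza; linarith
    · rw [hb] at hzb; linarith
    · rw [hb] at hzb; nlinarith
  have hres := integral_vertical_sub_eq_of_pole num w₁ (a := a) (b := b)
    (by rw [hw₁re]; linarith) (by rw [hw₁re]; linarith) hdiff ?_ ?_ ?_
  · rw [hnumw, mul_zero, sub_eq_zero] at hres
    have e1 : ∫ y : ℝ, num (b + y * I) / (b + y * I - w₁) = ∫ y : ℝ, finE s h Y M (b + y * I) :=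
      integral_congr_ae (Eventually.of_forall fun y ↦ hF _ (hlineB y))
    have e2 : ∫ y : ℝ, num (a + y * I) / (a + y * I - w₁) = ∫ y : ℝ, finE s h Y M (a + y * I) :=
      integral_congr_ae (Eventually.of_forall fun y ↦ hF _ (hlineA y))
    rw [e1, e2] at hres
    exact hres
  · exact (integrable_finE_line hs k hh hY M (c := a) le_rfl (by rw [ha]; linarith)).congr
      (Eventually.of_forall fun y ↦ (hF _ (hlineA y)).symm)
  · exact (integrable_finE_line hs k hh hY M (c := b) (by rw [hb, ha] at *; linarith)
      (by rw [hb]; linarith)).congr (Eventually.of_forall fun y ↦ (hF _ (hlineB y)).symm)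
  · intro ε hε
    set K : ℝ := 96 * π ^ 2 * M * (3 + k + |s.im| + h) ^ (k + 3) with hK
    have hK0 : 0 ≤ K := by rw [hK]; positivity
    obtain ⟨T₁, hT₁⟩ := exists_pow_mul_exp_le (k + 5) hK0 hε
    refine ⟨max T₁ 1, fun σ hσ T hT ↦ ?_⟩
    have hT1 : T₁ ≤ |T| := le_trans (le_max_left _ _) hT
    have hT2 : 1 ≤ |T| := le_trans (le_max_right _ _) hT
    have hne : ((σ : ℂ) + T * I) ≠ w₁ := by
      intro h'
      have := congrArg im h'
      rw [im_line, hw₁im] at this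
      rw [this] at hT2; simp at hT2; linarith
    rw [hF _ hne]
    exact (norm_finE_le hs k hh hY M (by rw [ha] at hσ; exact hσ.1) (by rw [hb] at hσ; linarith [hσ.2])
      hT2).trans (hT₁ T hT1)

/-- **The reflected integral on `re(s+w) = 1/2 − δ`**: for `re s = 1/2`, `0 < δ ≤ 1/2`, `h ≥ 2`,
`Y ≥ 1`,
`‖∫ (E_{2Y} − E_Y)(−δ/h + iy) dy‖ ≤ (192π²h²/δ)(1+|im s|)^δ ∫ (1+|y|)³e^{-π|y|/2} ‖A_M(v(y))‖ dy`,
`v(y) = 1 − s − h(−δ/h + iy) = 1/2 + δ − i(im s + hy)`. [cite: Ivic1985, Section 4.4 (4.67)] -/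
theorem norm_integral_finE_sub_le {s : ℂ} (hs : s.re = 1 / 2) {h : ℝ} (hh : 2 ≤ h) {Y : ℝ}
    (hY : 1 ≤ Y) (M : ℕ) {δ : ℝ} (hδ0 : 0 < δ) (hδ : δ ≤ 1 / 2) :
    ‖∫ y : ℝ, (finE s h (2 * Y) M ((-(δ / h) : ℝ) + y * I) - finE s h Y M ((-(δ / h) : ℝ) + y * I))‖ ≤
      (192 * π ^ 2 * h ^ 2 / δ) * (1 + |s.im|) ^ δ *
        ∫ y : ℝ, (1 + |y|) ^ 3 * Real.exp (-(π * |y| / 2)) *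
          ‖dirA M (1 - s - h * ((-(δ / h) : ℝ) + y * I))‖ := by
  have hh0 : 0 < h := by linarith
  have hY0 : 0 < Y := by linarith
  have hκ : δ / h ≤ 1 / 2 := by rw [div_le_iff₀ hh0]; nlinarith
  have hκ0 : 0 < δ / h := by positivity
  have ht0 := abs_nonneg s.im
  set C : ℝ := (192 * π ^ 2 * h ^ 2 / δ) * (1 + |s.im|) ^ δ with hC
  have hC0 : 0 ≤ C := by rw [hC]; positivity
  -- pointwise bound
  have hpt : ∀ y : ℝ, ‖finE s h (2 * Y) M ((-(δ / h) : ℝ) + y * I) - finE s h Y M ((-(δ / h) : ℝ) + y * I)‖ ≤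
      C * ((1 + |y|) ^ 3 * Real.exp (-(π * |y| / 2)) *
        ‖dirA M (1 - s - h * ((-(δ / h) : ℝ) + y * I))‖) := by
    intro y
    set z : ℂ := ((-(δ / h) : ℝ) : ℂ) + y * I with hz
    set v : ℂ := 1 - s - h * z with hv
    have hvre : v.re = 1 / 2 + δ := by rw [hv, hz]; simp [hs]; field_simp; ring
    have hvim : v.im = -(s.im + h * y) := by rw [hv, hz]; simp; ring
    have e : finE s h (2 * Y) M z - finE s h Y M z =
        Complex.Gamma z * ((((2 * Y : ℝ)) : ℂ) ^ ((h : ℂ) * z) - (Y : ℂ) ^ ((h : ℂ) * z)) *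
          feFactor v * dirA M v := by
      unfold finE; rw [← hv]; push_cast; ring
    rw [e, norm_mul, norm_mul, norm_mul]
    have hΓ : ‖Complex.Gamma z‖ ≤ 12 / (δ / h) * (1 + |y|) ^ 2 * Real.exp (-(π * |y| / 2)) := by
      have := norm_Gamma_neg_line_le_exp hκ0 hκ y
      rw [hz]; push_cast at this ⊢; exact this
    have hpow : ‖(((2 * Y : ℝ)) : ℂ) ^ ((h : ℂ) * z) - (Y : ℂ) ^ ((h : ℂ) * z)‖ ≤ 2 := by
      refine (norm_sub_le _ _).trans ?_
      have hre : ((h : ℂ) * z).re = -δ := by rw [hz]; simp; field_simp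
      have h1 : ‖(((2 * Y : ℝ)) : ℂ) ^ ((h : ℂ) * z)‖ ≤ 1 := by
        rw [norm_ofReal_cpow (by linarith), hre]
        exact Real.rpow_le_one_of_one_le_of_nonpos (by linarith) (by linarith)
      have h2 : ‖(Y : ℂ) ^ ((h : ℂ) * z)‖ ≤ 1 := by
        rw [norm_ofReal_cpow hY0, hre]
        exact Real.rpow_le_one_of_one_le_of_nonpos hY (by linarith)
      linarith
    have hF : ‖feFactor v‖ ≤ 8 * π ^ 2 * ((1 + |s.im|) ^ δ * (h * (1 + |y|))) := by
      have h1 := GammaVert.norm_fe_factor_le (s := v) (by rw [hvre]; linarith) (by rw [hvre]; linarith)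
      have h1' : ‖feFactor v‖ ≤ 8 * π ^ 2 * (1 + |v.im|) ^ (v.re - 1 / 2) := h1
      rw [hvre, hvim, abs_neg, show (1 / 2 + δ - 1 / 2 : ℝ) = δ by ring] at h1'
      refine h1'.trans ?_
      gcongr
      have hb1 : 1 ≤ 1 + |s.im| := by linarith
      have hb2 : 1 ≤ 1 + h * |y| := by nlinarith [abs_nonneg y]
      calc (1 + |s.im + h * y|) ^ δ ≤ ((1 + |s.im|) * (1 + h * |y|)) ^ δ := by
            refine Real.rpow_le_rpow (by positivity) ?_ hδ0.le
            calc 1 + |s.im + h * y| ≤ 1 + (|s.im| + h * |y|) := by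
                  gcongr
                  calc |s.im + h * y| ≤ |s.im| + |h * y| := abs_add_le _ _
                    _ = |s.im| + h * |y| := by rw [abs_mul, abs_of_pos hh0]
              _ ≤ (1 + |s.im|) * (1 + h * |y|) := by nlinarith [abs_nonneg y]
        _ = (1 + |s.im|) ^ δ * (1 + h * |y|) ^ δ := Real.mul_rpow (by positivity) (by positivity)
        _ ≤ (1 + |s.im|) ^ δ * (1 + h * |y|) := by
            gcongr
            calc (1 + h * |y|) ^ δ ≤ (1 + h * |y|) ^ (1 : ℝ) :=
                  Real.rpow_le_rpow_of_exponent_le hb2 (by linarith)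
              _ = 1 + h * |y| := Real.rpow_one _
        _ ≤ (1 + |s.im|) ^ δ * (h * (1 + |y|)) := by
            gcongr
            nlinarith [abs_nonneg y]
    have h12 : 12 / (δ / h) = 12 * h / δ := by field_simp
    rw [h12] at hΓ
    calc ‖Complex.Gamma z‖ * ‖(((2 * Y : ℝ)) : ℂ) ^ ((h : ℂ) * z) - (Y : ℂ) ^ ((h : ℂ) * z)‖ *
          ‖feFactor v‖ * ‖dirA M v‖
        ≤ (12 * h / δ * (1 + |y|) ^ 2 * Real.exp (-(π * |y| / 2))) * 2 *
            (8 * π ^ 2 * ((1 + |s.im|) ^ δ * (h * (1 + |y|)))) * ‖dirA M v‖ := by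
          gcongr
      _ = C * ((1 + |y|) ^ 3 * Real.exp (-(π * |y| / 2)) * ‖dirA M v‖) := by
          rw [hC]; field_simp; ring
  -- integrability of the majorant
  have hcontA : Continuous fun y : ℝ ↦ ‖dirA M (1 - s - h * ((-(δ / h) : ℝ) + y * I))‖ :=
    ((differentiable_dirA M).continuous.comp (by fun_prop)).norm
  have hmaj : Integrable fun y : ℝ ↦ (1 + |y|) ^ 3 * Real.exp (-(π * |y| / 2)) *
      ‖dirA M (1 - s - h * ((-(δ / h) : ℝ) + y * I))‖ := by
    refine ((integrable_pow_mul_exp 3).mul_const (M : ℝ)).mono' ?_ (Eventually.of_forall fun y ↦ ?_)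
    · exact ((by fun_prop : Continuous fun y : ℝ ↦ (1 + |y|) ^ 3 * Real.exp (-(π * |y| / 2))).mul
        hcontA).aestronglyMeasurable
    · rw [Real.norm_of_nonneg (by positivity)]
      refine mul_le_mul_of_nonneg_left (norm_dirA_le M ?_) (by positivity)
      simp [hs]; field_simp; linarith
  calc ‖∫ y : ℝ, (finE s h (2 * Y) M ((-(δ / h) : ℝ) + y * I) - finE s h Y M ((-(δ / h) : ℝ) + y * I))‖
      ≤ ∫ y : ℝ, ‖finE s h (2 * Y) M ((-(δ / h) : ℝ) + y * I) - finE s h Y M ((-(δ / h) : ℝ) + y * I)‖ :=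
        norm_integral_le_integral_norm _
    _ ≤ ∫ y : ℝ, C * ((1 + |y|) ^ 3 * Real.exp (-(π * |y| / 2)) *
          ‖dirA M (1 - s - h * ((-(δ / h) : ℝ) + y * I))‖) :=
        integral_mono_of_nonneg (Eventually.of_forall fun y ↦ norm_nonneg _) (hmaj.const_mul C)
          (Eventually.of_forall hpt)
    _ = C * ∫ y : ℝ, (1 + |y|) ^ 3 * Real.exp (-(π * |y| / 2)) *
          ‖dirA M (1 - s - h * ((-(δ / h) : ℝ) + y * I))‖ := integral_const_mul _ _

/-! ## §6. The residue at `z₀`, and the assembled reflection principle -/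

/-- **The residue at `z₀ = (1−s)/h` is negligible**: for `re s = 1/2`, `1 ≤ h ≤ |im s|`, `Y > 0`,
`‖Γ(z₀) Y^{hz₀} ζ₁(1)/h‖ ≤ 16π² (1+|im s|/h)^{1/2} e^{-π|im s|/(2h)} Y^{1/2}/h` (Ivić: "the residue
coming from the pole `w = 1 − s` is `o(1)`" by Stirling's formula; here the tree's
`‖Γ(x+iy)‖ ≤ 16π²(1+|y|)^{1/2}e^{-π|y|/2}` on `0 < x ≤ 1`). [cite: Ivic1985, Section 4.4, proof of (4.61)] -/
theorem norm_numA_le {s : ℂ} (hs : s.re = 1 / 2) {h : ℝ} (hh : 1 ≤ h) (ht : h ≤ |s.im|) {Y : ℝ}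
    (hY : 0 < Y) :
    ‖numA s h Y ((1 - s) / h)‖ ≤ 16 * π ^ 2 * (1 + |s.im| / h) ^ (1 / 2 : ℝ) *
      Real.exp (-(π * (|s.im| / h)) / 2) * Y ^ (1 / 2 : ℝ) / h := by
  have hh0 : 0 < h := by linarith
  set z₀ : ℂ := (1 - s) / h with hz₀
  have hz₀' : z₀ = ((1 / (2 * h) : ℝ) : ℂ) + ((-s.im / h : ℝ) : ℂ) * I := by
    apply Complex.ext
    · rw [hz₀, div_ofReal_re, sub_re, one_re, hs]; simp; ring
    · rw [hz₀, div_ofReal_im, sub_im, one_im]; simp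
  have hsz : s + h * z₀ = 1 := by
    have hh' : (h : ℂ) ≠ 0 := ofReal_ne_zero.2 hh0.ne'
    rw [hz₀]; field_simp; ring
  unfold numA
  rw [hsz, riemannZeta₁_one, mul_one, norm_div, Complex.norm_real, Real.norm_of_nonneg hh0.le,
    norm_mul, norm_cpow_ofReal_mul hY]
  have hre : h * z₀.re = 1 / 2 := by rw [hz₀']; rw [re_line]; field_simp
  rw [hre]
  have hΓ : ‖Complex.Gamma z₀‖ ≤ 16 * π ^ 2 * (1 + |s.im| / h) ^ (1 / 2 : ℝ) *
      Real.exp (-(π * (|s.im| / h)) / 2) := by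
    rw [hz₀']
    have hy : 1 ≤ |(-s.im / h : ℝ)| := by
      rw [abs_div, abs_neg, abs_of_pos hh0, le_div_iff₀ hh0]; linarith
    have h1 := norm_Gamma_le_exp (x := 1 / (2 * h)) (y := -s.im / h) (by positivity)
      (by rw [div_le_iff₀ (by positivity)]; linarith) hy
    rwa [abs_div, abs_neg, abs_of_pos hh0] at h1
  gcongr

/-- **The smoothed critical-line sum** `W_h(Y, s) = ∑_{m≥1} e^{-(m/Y)^h} m^{-s}`.
[cite: Ivic1985, Section 4.4 (4.60)] -/
def wsum (s : ℂ) (h Y : ℝ) : ℂ :=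
  ∑' m : ℕ, (Real.exp (-(((m + 1 : ℝ) / Y) ^ h)) : ℂ) * ((m : ℂ) + 1) ^ (-s)

/-- **The reflection identity** (Ivić (4.61)–(4.65) for `k = 1`, difference of `2Y` and `Y`): for
`re s = 1/2`, `2(k+1) ≤ h`, `Y ≥ 1`, `0 < δ ≤ 1/2`,
`W(2Y) − W(Y) = (residues at z₀) + (2π)^{-1}(tail integrals) + (2π)^{-1}∫(E_{2Y} − E_Y)(−δ/h+iy) dy`
(the residues `ζ(s)` at `z = 0` cancel). [cite: Ivic1985, Section 4.4 (4.61)–(4.65)] -/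
theorem wsum_sub_wsum_eq {s : ℂ} (hs : s.re = 1 / 2) (k : ℕ) {h : ℝ} (hh : 2 * (k + 1) ≤ h)
    {Y : ℝ} (hY : 1 ≤ Y) (M : ℕ) {δ : ℝ} (hδ0 : 0 < δ) (hδ : δ ≤ 1 / 2) :
    wsum s h (2 * Y) - wsum s h Y =
      (numA s h (2 * Y) ((1 - s) / h) - numA s h Y ((1 - s) / h)) +
      (1 / (2 * π)) * ((∫ y : ℝ, tailT s h (2 * Y) M ((-((k + 1) / h) : ℝ) + y * I)) -
        ∫ y : ℝ, tailT s h Y M ((-((k + 1) / h) : ℝ) + y * I)) +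
      (1 / (2 * π)) * ∫ y : ℝ, (finE s h (2 * Y) M ((-(δ / h) : ℝ) + y * I) -
        finE s h Y M ((-(δ / h) : ℝ) + y * I)) := by
  have hk0 : (0 : ℝ) ≤ k := k.cast_nonneg
  have hh1 : 1 ≤ h := by linarith
  have hh0 : 0 < h := by linarith
  have hY2 : 1 ≤ 2 * Y := by linarith
  have hsre : 1 < s.re + 2 * h := by rw [hs]; linarith
  have hπ : (2 * (π : ℂ)) ≠ 0 := by simp [Real.pi_ne_zero]
  -- the six equations, for `Y' = Y` and `Y' = 2Y`
  have eq1 : ∀ {Y' : ℝ}, 1 ≤ Y' → wsum s h Y' = (1 / (2 * π)) * ∫ y : ℝ, mel s h Y' ((2 : ℝ) + y * I) := by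
    intro Y' hY'
    rw [wsum, tsum_weight_eq_integral (by linarith) hsre]
    congr 1
  have eq2 : ∀ {Y' : ℝ}, 1 ≤ Y' → (1 / (2 * π)) * (∫ y : ℝ, mel s h Y' ((2 : ℝ) + y * I)) =
      (1 / (2 * π)) * (∫ y : ℝ, mel s h Y' ((1 / (4 * h) : ℝ) + y * I)) + numA s h Y' ((1 - s) / h) := by
    intro Y' hY'
    have h2 := shift_two_quarter hs hh1 hY'
    generalize (∫ y : ℝ, mel s h Y' ((2 : ℝ) + y * I)) = A at h2 ⊢
    generalize (∫ y : ℝ, mel s h Y' ((1 / (4 * h) : ℝ) + y * I)) = B at h2 ⊢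
    generalize numA s h Y' ((1 - s) / h) = C at h2 ⊢
    rw [sub_eq_iff_eq_add] at h2
    rw [h2]; field_simp; ring
  have eq3 : ∀ {Y' : ℝ}, 1 ≤ Y' → (1 / (2 * π)) * (∫ y : ℝ, mel s h Y' ((1 / (4 * h) : ℝ) + y * I)) =
      (1 / (2 * π)) * (∫ y : ℝ, mel s h Y' ((-((k + 1) / h) : ℝ) + y * I)) + riemannZeta s := by
    intro Y' hY'
    have h2 := shift_quarter_left hs k hh hY'
    generalize (∫ y : ℝ, mel s h Y' ((1 / (4 * h) : ℝ) + y * I)) = A at h2 ⊢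
    generalize (∫ y : ℝ, mel s h Y' ((-((k + 1) / h) : ℝ) + y * I)) = B at h2 ⊢
    rw [sub_eq_iff_eq_add] at h2
    rw [h2]; field_simp; ring
  have eq4 : ∀ {Y' : ℝ}, 1 ≤ Y' → (∫ y : ℝ, mel s h Y' ((-((k + 1) / h) : ℝ) + y * I)) =
      (∫ y : ℝ, finE s h Y' M ((-((k + 1) / h) : ℝ) + y * I)) +
        ∫ y : ℝ, tailT s h Y' M ((-((k + 1) / h) : ℝ) + y * I) := by
    intro Y' hY'
    rw [← integral_add (integrable_finE_line hs k hh hY' M le_rfl (by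
        have : 0 < (k + 1) / h := by positivity
        linarith)) (integrable_tailT_line hs k hh hY' M)]
    exact integral_congr_ae (Eventually.of_forall fun y ↦ mel_eq_finE_add_tailT hs k hh0 Y' M y)
  have eq5 : ∀ {Y' : ℝ}, 1 ≤ Y' → (∫ y : ℝ, finE s h Y' M ((-((k + 1) / h) : ℝ) + y * I)) =
      ∫ y : ℝ, finE s h Y' M ((-(δ / h) : ℝ) + y * I) := fun hY' ↦ (shift_finE hs k hh hY' M hδ0 hδ).symm
  have hδk : -((k + 1 : ℝ) / h) ≤ -(δ / h) := by
    rw [neg_le_neg_iff, div_le_div_iff_of_pos_right hh0]; linarith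
  have hδneg : -(δ / h) < 0 := neg_lt_zero.2 (by positivity)
  have eq6 : (∫ y : ℝ, (finE s h (2 * Y) M ((-(δ / h) : ℝ) + y * I) -
      finE s h Y M ((-(δ / h) : ℝ) + y * I))) =
      (∫ y : ℝ, finE s h (2 * Y) M ((-(δ / h) : ℝ) + y * I)) -
        ∫ y : ℝ, finE s h Y M ((-(δ / h) : ℝ) + y * I) :=
    integral_sub (integrable_finE_line hs k hh hY2 M hδk hδneg) (integrable_finE_line hs k hh hY M hδk hδneg)
  rw [eq1 hY2, eq1 hY, eq2 hY2, eq2 hY, eq3 hY2, eq3 hY, eq4 hY2, eq4 hY, eq5 hY2, eq5 hY, eq6]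
  ring

/-- The bound for the residue term. [cite: Ivic1985, Section 4.4, proof of (4.61)] -/
def resB (t h Y : ℝ) : ℝ :=
  16 * π ^ 2 * (1 + |t| / h) ^ (1 / 2 : ℝ) * Real.exp (-(π * (|t| / h)) / 2) * Y ^ (1 / 2 : ℝ) / h

/-- The bound for the tail integral `J₂`. [cite: Ivic1985, Section 4.4 (4.64)] -/
def tailB (k : ℕ) (t h Y : ℝ) (M : ℕ) : ℝ :=
  (384 * π ^ 2 * S0 * (h / (k + 1)) * (3 + k + |t| + h) ^ (k + 3) *
    Y ^ (-((k : ℝ) + 1)) * ((M : ℝ) + 1) ^ (-((k : ℝ) + 1 / 4))) * (2 * (2 * (k + 5 : ℕ) + 2) ^ (k + 5))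

/-- The main term: the weighted integral of the reflected Dirichlet polynomial along
`re(s+w) = 1/2 − δ`. [cite: Ivic1985, Section 4.4 (4.67)] -/
def mainI (s : ℂ) (h : ℝ) (M : ℕ) (δ : ℝ) : ℝ :=
  ∫ y : ℝ, (1 + |y|) ^ 3 * Real.exp (-(π * |y| / 2)) * ‖dirA M (1 - s - h * ((-(δ / h) : ℝ) + y * I))‖

/-- `mainI ≥ 0`. [folklore] -/
theorem mainI_nonneg (s : ℂ) (h : ℝ) (M : ℕ) (δ : ℝ) : 0 ≤ mainI s h M δ :=
  integral_nonneg fun y ↦ by positivity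

/-- **The reflection principle for the smoothed critical-line zeta sum (Ivić (4.67), variant).**
For `re s = 1/2`, `k ∈ ℕ`, `2(k+1) ≤ h ≤ |im s|`, `Y ≥ 1`, `M ∈ ℕ`, `0 < δ ≤ 1/2`:
`‖∑_{m≥1} (e^{-(m/2Y)^h} − e^{-(m/Y)^h}) m^{-s}‖ ≤ resB(2Y) + resB(Y)
  + (2π)^{-1}(tailB(2Y) + tailB(Y)) + (2π)^{-1}(192π²h²/δ)(1+|im s|)^δ · mainI`,
where `mainI = ∫ (1+|y|)³e^{-π|y|/2} ‖∑_{n≤M} n^{-(1/2+δ)+i(im s + hy)}‖ dy`, the residue bound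
`resB(Y) = 16π²(1+|im s|/h)^{1/2}e^{-π|im s|/(2h)}Y^{1/2}/h` and the tail bound
`tailB(Y) ≍_k h(3+k+|im s|+h)^{k+3} Y^{-(k+1)}(M+1)^{-(k+1/4)}` (Ivić:
`≪ 1 + Y^{1/2−σ}∫_{-h²}^{h²}|∑_{n≤M} n^{-1/2+it+iv}| dv` for `M ≥ 3TY^{-1}`; here the line of the
tail estimate is fixed, so `M` of size `T^{1+O(1/k)}/Y` is needed to make `tailB` small).
[cite: Ivic1985, Section 4.4 (4.67)] -/
theorem norm_wsum_sub_wsum_le {s : ℂ} (hs : s.re = 1 / 2) (k : ℕ) {h : ℝ} (hh : 2 * (k + 1) ≤ h)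
    (ht : h ≤ |s.im|) {Y : ℝ} (hY : 1 ≤ Y) (M : ℕ) {δ : ℝ} (hδ0 : 0 < δ) (hδ : δ ≤ 1 / 2) :
    ‖wsum s h (2 * Y) - wsum s h Y‖ ≤
      resB s.im h (2 * Y) + resB s.im h Y +
      (1 / (2 * π)) * (tailB k s.im h (2 * Y) M + tailB k s.im h Y M) +
      (1 / (2 * π)) * ((192 * π ^ 2 * h ^ 2 / δ) * (1 + |s.im|) ^ δ * mainI s h M δ) := by
  have hk0 : (0 : ℝ) ≤ k := k.cast_nonneg
  have hh1 : 1 ≤ h := by linarith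
  have hY0 : 0 < Y := by linarith
  have hY2 : 1 ≤ 2 * Y := by linarith
  have hπ0 : 0 ≤ 1 / (2 * π) := by positivity
  rw [wsum_sub_wsum_eq hs k hh hY M hδ0 hδ]
  have hA : ‖numA s h (2 * Y) ((1 - s) / h) - numA s h Y ((1 - s) / h)‖ ≤
      resB s.im h (2 * Y) + resB s.im h Y :=
    (norm_sub_le _ _).trans (add_le_add (norm_numA_le hs hh1 ht (by linarith))
      (norm_numA_le hs hh1 ht hY0))
  have hT : ‖(1 / (2 * π) : ℂ) * ((∫ y : ℝ, tailT s h (2 * Y) M ((-((k + 1) / h) : ℝ) + y * I)) -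
        ∫ y : ℝ, tailT s h Y M ((-((k + 1) / h) : ℝ) + y * I))‖ ≤
      (1 / (2 * π)) * (tailB k s.im h (2 * Y) M + tailB k s.im h Y M) := by
    rw [norm_mul, show ‖(1 / (2 * π) : ℂ)‖ = 1 / (2 * π) by
      rw [show (1 / (2 * π) : ℂ) = ((1 / (2 * π) : ℝ) : ℂ) by push_cast; ring, Complex.norm_real,
        Real.norm_of_nonneg hπ0]]
    refine mul_le_mul_of_nonneg_left ((norm_sub_le _ _).trans (add_le_add ?_ ?_)) hπ0
    · exact (norm_integral_le_integral_norm _).trans (integral_norm_tailT_le hs k hh hY2 M)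
    · exact (norm_integral_le_integral_norm _).trans (integral_norm_tailT_le hs k hh hY M)
  have hE : ‖(1 / (2 * π) : ℂ) * ∫ y : ℝ, (finE s h (2 * Y) M ((-(δ / h) : ℝ) + y * I) -
        finE s h Y M ((-(δ / h) : ℝ) + y * I))‖ ≤
      (1 / (2 * π)) * ((192 * π ^ 2 * h ^ 2 / δ) * (1 + |s.im|) ^ δ * mainI s h M δ) := by
    rw [norm_mul, show ‖(1 / (2 * π) : ℂ)‖ = 1 / (2 * π) by
      rw [show (1 / (2 * π) : ℂ) = ((1 / (2 * π) : ℝ) : ℂ) by push_cast; ring, Complex.norm_real,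
        Real.norm_of_nonneg hπ0]]
    exact mul_le_mul_of_nonneg_left (norm_integral_finE_sub_le hs (by linarith) hY M hδ0 hδ) hπ0
  calc _ ≤ ‖numA s h (2 * Y) ((1 - s) / h) - numA s h Y ((1 - s) / h)‖ +
        ‖(1 / (2 * π) : ℂ) * ((∫ y : ℝ, tailT s h (2 * Y) M ((-((k + 1) / h) : ℝ) + y * I)) -
          ∫ y : ℝ, tailT s h Y M ((-((k + 1) / h) : ℝ) + y * I))‖ +
        ‖(1 / (2 * π) : ℂ) * ∫ y : ℝ, (finE s h (2 * Y) M ((-(δ / h) : ℝ) + y * I) -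
          finE s h Y M ((-(δ / h) : ℝ) + y * I))‖ := norm_add₃_le
    _ ≤ _ := add_le_add (add_le_add hA hT) hE

end DZSReflection

end Literature.NumberTheory.LFunctions
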